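import Literature.RepresentationTheory.ModularTensorCategories.TemperleyLieb.Vertex

/-!
# Temperley–Lieb recoupling theory (4/6): Label-level vertices and trees, the F-move modulo negligibles, the pentagon; The elementary recoupling coefficients with a label 1 (`E₊₊, E₋₊, E₋₋, E₊₋`)

Part of the sorry-free formalization of Kauffman–Lins' recoupling theory in the binor model
(definitions and overview: `TemperleyLieb/Defs.lean`). Theorem-only file.

## References
* L. H. Kauffman, S. Lins, *Temperley–Lieb Recoupling Theory and Invariants of 3-Manifolds* (1994). [KauffmanLins1994]
* G. Masbaum, P. Vogel, *3-valent graphs and the Kauffman bracket*, Pacific J. Math. 164 (1994). [MasbaumVogel1994]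
-/

noncomputable section

open BigOperators Finset

namespace Literature.RepresentationTheory.ModularTensorCategories

namespace TemperleyLieb

variable {K : Type*} [Field K]
variable {m n p m' n' p' m'' n'' : ℕ}

open Mor

variable {A : K}

/-! ### Label-level vertices and trees -/

namespace Mor

variable (A : K)


variable {A}

/-- Bookkeeping lemma `vert_cast_eq` of the binor tensor model of Temperley–Lieb recoupling theory (conventions of KL94 §8.2, §9). [folklore] -/
theorem vert_cast_eq {x z y x' z' y' : ℕ} (hx : x' = x) (hz : z' = z) (hy : y' = y) (e1 : x' + y' = x + y)
    (e2 : (x' + z') + (y' + z') = (x + z) + (y + z)) : (vert A x' z' y').cast e1 e2 = vert A x z y := by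
  subst hx hz hy; rfl

/-- Bookkeeping lemma `dvert_cast_eq` of the binor tensor model of Temperley–Lieb recoupling theory (conventions of KL94 §8.2, §9). [folklore] -/
theorem dvert_cast_eq {x z y x' z' y' : ℕ} (hx : x' = x) (hz : z' = z) (hy : y' = y)
    (e2 : (x' + z') + (y' + z') = (x + z) + (y + z)) (e1 : x' + y' = x + y) :
    (dvert A x' z' y').cast e2 e1 = dvert A x z y := by
  subst hx hz hy; rfl

/-- Bookkeeping lemma `V_eq` of the binor tensor model of Temperley–Lieb recoupling theory (conventions of KL94 §8.2, §9). [folklore] -/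
theorem V_eq (x z y : ℕ) : V A (x + z) (y + z) (x + y) = vert A x z y := by
  rw [V, dif_pos (tri_mk x z y)]
  exact vert_cast_eq (by omega) (by omega) (by omega) _ _

/-- Bookkeeping lemma `Vd_eq` of the binor tensor model of Temperley–Lieb recoupling theory (conventions of KL94 §8.2, §9). [folklore] -/
theorem Vd_eq (x z y : ℕ) : Vd A (x + z) (y + z) (x + y) = dvert A x z y := by
  rw [Vd, dif_pos (tri_mk x z y)]
  exact dvert_cast_eq (by omega) (by omega) (by omega) _ _

/-- Bookkeeping lemma `V_of_not_tri` of the binor tensor model of Temperley–Lieb recoupling theory (conventions of KL94 §8.2, §9). [folklore] -/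
theorem V_of_not_tri {a b c : ℕ} (h : ¬Tri a b c) : V A a b c = 0 := by rw [V, dif_neg h]
/-- Bookkeeping lemma `Vd_of_not_tri` of the binor tensor model of Temperley–Lieb recoupling theory (conventions of KL94 §8.2, §9). [folklore] -/
theorem Vd_of_not_tri {a b c : ℕ} (h : ¬Tri a b c) : Vd A a b c = 0 := by rw [Vd, dif_neg h]

/-- Bookkeeping lemma `V` of the binor tensor model of Temperley–Lieb recoupling theory (conventions of KL94 §8.2, §9). [folklore] -/
theorem _root_.Literature.RepresentationTheory.ModularTensorCategories.TemperleyLieb.IsTL.V (a b c : ℕ) : IsTL A (V A a b c) := by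
  by_cases h : Tri a b c
  · obtain ⟨x, z, y, rfl, rfl, rfl⟩ := h.decompose
    rw [V_eq]; exact IsTL.vert x z y
  · rw [V_of_not_tri h]; exact IsTL.zero

/-- Bookkeeping lemma `Vd` of the binor tensor model of Temperley–Lieb recoupling theory (conventions of KL94 §8.2, §9). [folklore] -/
theorem _root_.Literature.RepresentationTheory.ModularTensorCategories.TemperleyLieb.IsTL.Vd (a b c : ℕ) : IsTL A (Vd A a b c) := by
  by_cases h : Tri a b c
  · obtain ⟨x, z, y, rfl, rfl, rfl⟩ := h.decompose
    rw [Vd_eq]; exact IsTL.dvert x z y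
  · rw [Vd_of_not_tri h]; exact IsTL.zero

/-- Bookkeeping lemma `vert_comp_jw` of the binor tensor model of Temperley–Lieb recoupling theory (conventions of KL94 §8.2, §9). [folklore] -/
theorem vert_comp_jw (hA : A ≠ 0) (x z y : ℕ) (hg : Good A (x + y)) : vert A x z y ⊚ jw A (x + y) = vert A x z y := by
  rw [vert_def, ← comp_assoc _ (jw A (x + y)) (jw A (x + y)), jw_idem' hA hg]

/-- Bookkeeping lemma `jw_tens_jw_comp_vert` of the binor tensor model of Temperley–Lieb recoupling theory (conventions of KL94 §8.2, §9). [folklore] -/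
theorem jw_tens_jw_comp_vert (hA : A ≠ 0) (x z y : ℕ) (hga : Good A (x + z)) (hgb : Good A (y + z)) :
    (jw A (x + z) ⊗ₘ jw A (y + z)) ⊚ vert A x z y = vert A x z y := by
  rw [vert_def, comp_assoc, comp_assoc, tens_comp_tens, jw_idem' hA hga, jw_idem' hA hgb]

/-- Bookkeeping lemma `jw_comp_dvert` of the binor tensor model of Temperley–Lieb recoupling theory (conventions of KL94 §8.2, §9). [folklore] -/
theorem jw_comp_dvert (hA : A ≠ 0) (x z y : ℕ) (hg : Good A (x + y)) : jw A (x + y) ⊚ dvert A x z y = dvert A x z y := by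
  rw [dvert_def, comp_assoc, comp_assoc, jw_idem' hA hg]

/-- Bookkeeping lemma `dvert_comp_jw_tens_jw` of the binor tensor model of Temperley–Lieb recoupling theory (conventions of KL94 §8.2, §9). [folklore] -/
theorem dvert_comp_jw_tens_jw (hA : A ≠ 0) (x z y : ℕ) (hga : Good A (x + z)) (hgb : Good A (y + z)) :
    dvert A x z y ⊚ (jw A (x + z) ⊗ₘ jw A (y + z)) = dvert A x z y := by
  rw [dvert_def, ← comp_assoc _ (jw A (x + z) ⊗ₘ jw A (y + z)), tens_comp_tens, jw_idem' hA hga, jw_idem' hA hgb]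

/-- Bookkeeping lemma `V_comp_jw` of the binor tensor model of Temperley–Lieb recoupling theory (conventions of KL94 §8.2, §9). [folklore] -/
theorem V_comp_jw (hA : A ≠ 0) (a b c : ℕ) (hg : Good A c) : V A a b c ⊚ jw A c = V A a b c := by
  by_cases h : Tri a b c
  · obtain ⟨x, z, y, rfl, rfl, rfl⟩ := h.decompose
    rw [V_eq, vert_comp_jw hA x z y hg]
  · rw [V_of_not_tri h, zero_comp]

/-- Bookkeeping lemma `jw_tens_jw_comp_V` of the binor tensor model of Temperley–Lieb recoupling theory (conventions of KL94 §8.2, §9). [folklore] -/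
theorem jw_tens_jw_comp_V (hA : A ≠ 0) (a b c : ℕ) (hga : Good A a) (hgb : Good A b) :
    (jw A a ⊗ₘ jw A b) ⊚ V A a b c = V A a b c := by
  by_cases h : Tri a b c
  · obtain ⟨x, z, y, rfl, rfl, rfl⟩ := h.decompose
    rw [V_eq, jw_tens_jw_comp_vert hA x z y hga hgb]
  · rw [V_of_not_tri h, comp_zero]

/-- Bookkeeping lemma `jw_comp_Vd` of the binor tensor model of Temperley–Lieb recoupling theory (conventions of KL94 §8.2, §9). [folklore] -/
theorem jw_comp_Vd (hA : A ≠ 0) (a b c : ℕ) (hg : Good A c) : jw A c ⊚ Vd A a b c = Vd A a b c := by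
  by_cases h : Tri a b c
  · obtain ⟨x, z, y, rfl, rfl, rfl⟩ := h.decompose
    rw [Vd_eq, jw_comp_dvert hA x z y hg]
  · rw [Vd_of_not_tri h, comp_zero]

/-- Bookkeeping lemma `Vd_comp_jw_tens_jw` of the binor tensor model of Temperley–Lieb recoupling theory (conventions of KL94 §8.2, §9). [folklore] -/
theorem Vd_comp_jw_tens_jw (hA : A ≠ 0) (a b c : ℕ) (hga : Good A a) (hgb : Good A b) :
    Vd A a b c ⊚ (jw A a ⊗ₘ jw A b) = Vd A a b c := by
  by_cases h : Tri a b c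
  · obtain ⟨x, z, y, rfl, rfl, rfl⟩ := h.decompose
    rw [Vd_eq, dvert_comp_jw_tens_jw hA x z y hga hgb]
  · rw [Vd_of_not_tri h, zero_comp]

/-- Vertex uniqueness by labels: `(f_a ⊗ f_b) X f_c = κ V(a,b;c)` for Temperley–Lieb `X`. [cite: KauffmanLins1994, §9.9] -/
theorem sandwich_V (hA : A ≠ 0) {a b c : ℕ} {X : Mor K c (a + b)} (hX : IsTL A X) (hga : Good A a) (hgb : Good A b)
    (hgc : Good A c) : ∃ κ : K, (jw A a ⊗ₘ jw A b) ⊚ X ⊚ jw A c = κ • V A a b c := by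
  by_cases h : Tri a b c
  · obtain ⟨x, z, y, rfl, rfl, rfl⟩ := h.decompose
    rw [V_eq]; exact sandwich_eq_smul_vert hA x z y hX hga hgb hgc
  · refine ⟨0, ?_⟩
    rw [zero_smul]
    exact sandwich_eq_zero hA hX hga hgb hgc (fun x y z h1 h2 h3 => h (by subst h1 h2 h3; exact tri_mk x z y))

variable (A)


variable {A}

/-- Bookkeeping lemma `thetaL_eq` of the binor tensor model of Temperley–Lieb recoupling theory (conventions of KL94 §8.2, §9). [folklore] -/
theorem thetaL_eq (x z y : ℕ) : thetaL A (x + z) (y + z) (x + y) = theta A x z y := by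
  rw [thetaL, V_eq, Vd_eq, theta]

/-- Bookkeeping lemma `thetaL_of_not_tri` of the binor tensor model of Temperley–Lieb recoupling theory (conventions of KL94 §8.2, §9). [folklore] -/
theorem thetaL_of_not_tri {a b c : ℕ} (h : ¬Tri a b c) : thetaL A a b c = 0 := by
  rw [thetaL, V_of_not_tri h, comp_zero, trAll_zero_mor]

/-- Bookkeeping lemma `treeL` of the binor tensor model of Temperley–Lieb recoupling theory (conventions of KL94 §8.2, §9). [folklore] -/
theorem _root_.Literature.RepresentationTheory.ModularTensorCategories.TemperleyLieb.IsTL.treeL (a b c e f : ℕ) :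
    IsTL A (treeL A a b c e f) := ((IsTL.V a b f).tens_idm c).comp _ (IsTL.V f c e)

/-- Bookkeeping lemma `treeR` of the binor tensor model of Temperley–Lieb recoupling theory (conventions of KL94 §8.2, §9). [folklore] -/
theorem _root_.Literature.RepresentationTheory.ModularTensorCategories.TemperleyLieb.IsTL.treeR (a b c e g : ℕ) :
    IsTL A (treeR A a b c e g) := (((IsTL.idm a).tens (IsTL.V b c g)).cast _ _).comp _ (IsTL.V a g e)

/-- Bookkeeping lemma `treeRd` of the binor tensor model of Temperley–Lieb recoupling theory (conventions of KL94 §8.2, §9). [folklore] -/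
theorem _root_.Literature.RepresentationTheory.ModularTensorCategories.TemperleyLieb.IsTL.treeRd (a b c e g : ℕ) :
    IsTL A (treeRd A a b c e g) := (IsTL.Vd a g e).comp _ (((IsTL.idm a).tens (IsTL.Vd b c g)).cast _ _)

/-- **The bubble** by labels: `V^∨(a,b;c) V(a,b;c) = (θ(a,b,c)/Δ_c) f_c`. [cite: KauffmanLins1994, §5.1 Lemma 7, §9.10] -/
theorem Vd_comp_V_self (hA : A ≠ 0) (a b c : ℕ) (hga : Good A a) (hgb : Good A b) (hgc : Good A (c + 1)) :
    Vd A a b c ⊚ V A a b c = (thetaL A a b c / Delta A c) • jw A c := by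
  by_cases h : Tri a b c
  · obtain ⟨x, z, y, rfl, rfl, rfl⟩ := h.decompose
    rw [V_eq, Vd_eq, thetaL_eq, dvert_comp_vert hA x z y hga hgb hgc]
  · rw [V_of_not_tri h, thetaL_of_not_tri h, comp_zero, zero_div, zero_smul]

/-- Bookkeeping lemma `Vd_congr` of the binor tensor model of Temperley–Lieb recoupling theory (conventions of KL94 §8.2, §9). [folklore] -/
theorem Vd_congr {a a' b b' c : ℕ} (ha : a = a') (hb : b = b') :
    Vd A a b c = (Vd A a' b' c).cast (by rw [ha, hb]) rfl := by subst ha hb; rfl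

/-- Bookkeeping lemma `V_congr` of the binor tensor model of Temperley–Lieb recoupling theory (conventions of KL94 §8.2, §9). [folklore] -/
theorem V_congr {a a' b b' c : ℕ} (ha : a = a') (hb : b = b') :
    V A a b c = (V A a' b' c).cast rfl (by rw [ha, hb]) := by subst ha hb; rfl

/-- **The bubble**, off-diagonal: `V^∨(a,b;c') V(a,b;c) = 0` for `c ≠ c'`. [cite: KauffmanLins1994, §5.1 Lemma 7] -/
theorem Vd_comp_V_ne (hA : A ≠ 0) {a b c c' : ℕ} (hc : c ≠ c') (hgc : Good A c) (hgc' : Good A c') :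
    Vd A a b c' ⊚ V A a b c = 0 := by
  by_cases h : Tri a b c
  · by_cases h' : Tri a b c'
    · obtain ⟨x, z, y, rfl, rfl, rfl⟩ := h.decompose
      obtain ⟨x', z', y', ha, hb, rfl⟩ := h'.decompose
      rw [V_eq, Vd_congr ha hb, Vd_eq]
      exact dvert_comp_vert_eq_zero hA ha.symm hb.symm (Ne.symm hc) hgc hgc'
    · rw [Vd_of_not_tri h', zero_comp]
  · rw [V_of_not_tri h, comp_zero]

end Mor


namespace Mor

variable {A : K}

/-- Bookkeeping lemma `idm_tens_jw_comp_V` of the binor tensor model of Temperley–Lieb recoupling theory (conventions of KL94 §8.2, §9). [folklore] -/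
theorem idm_tens_jw_comp_V (hA : A ≠ 0) (a g e : ℕ) (hga : Good A a) (hgg : Good A g) :
    (idm a ⊗ₘ jw A g) ⊚ V A a g e = V A a g e := by
  conv_lhs => rw [← jw_tens_jw_comp_V hA a g e hga hgg]
  rw [comp_assoc, tens_comp_tens, idm_comp, jw_idem' hA hgg, jw_tens_jw_comp_V hA a g e hga hgg]

/-- **Tree bubble**: `R^∨_h R_g = δ_{gh} (θ(b,c,g)/Δ_g)(θ(a,g,e)/Δ_e) f_e`. [cite: KauffmanLins1994, §7.3 (proof of Prop. 11)] -/
theorem treeRd_comp_treeR (hA : A ≠ 0) (a b c e g h : ℕ) (hga : Good A a) (hgb : Good A b) (hgc : Good A c)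
    (hgg : Good A (g + 1)) (hgh : Good A h) (hge : Good A (e + 1)) :
    treeRd A a b c e h ⊚ treeR A a b c e g =
      if g = h then (thetaL A b c g / Delta A g * (thetaL A a g e / Delta A e)) • jw A e else 0 := by
  rw [treeRd, treeR, comp_assoc, ← comp_assoc (Vd A a h e), cast_comp_cast, idm_tens_comp_idm_tens, cast_rfl]
  split_ifs with hgh'
  · subst hgh'
    rw [Vd_comp_V_self hA b c g hgb hgc hgg, tens_smul, comp_smul, smul_comp, ← comp_assoc,
      idm_tens_jw_comp_V hA a g e hga (hgg.mono (Nat.le_succ g)), Vd_comp_V_self hA a g e hga (hgg.mono (Nat.le_succ g)) hge,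
      smul_smul]
  · rw [Vd_comp_V_ne hA hgh' (hgg.mono (Nat.le_succ g)) hgh, tens_zero, comp_zero, zero_comp]

/-- Bookkeeping lemma `trAll_treeRd_comp_treeR` of the binor tensor model of Temperley–Lieb recoupling theory (conventions of KL94 §8.2, §9). [folklore] -/
theorem trAll_treeRd_comp_treeR (hA : A ≠ 0) (a b c e g h : ℕ) (hga : Good A a) (hgb : Good A b) (hgc : Good A c)
    (hgg : Good A (g + 1)) (hgh : Good A h) (hge : Good A (e + 1)) :
    trAll A (treeRd A a b c e h ⊚ treeR A a b c e g) =
      if g = h then thetaL A b c g * thetaL A a g e / Delta A g else 0 := by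
  rw [treeRd_comp_treeR hA a b c e g h hga hgb hgc hgg hgh hge]
  split_ifs
  · rw [trAll_smul, trAll_jw hA e (hge.mono (Nat.le_succ e))]
    field_simp [hge e (Nat.lt_succ_self e)]
  · rw [trAll_zero_mor]

/-- Bookkeeping lemma `treeL_comp_jw` of the binor tensor model of Temperley–Lieb recoupling theory (conventions of KL94 §8.2, §9). [folklore] -/
theorem treeL_comp_jw (hA : A ≠ 0) (a b c e f : ℕ) (hge : Good A e) : treeL A a b c e f ⊚ jw A e = treeL A a b c e f := by
  rw [treeL, ← comp_assoc, V_comp_jw hA f c e hge]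

/-- Bookkeeping lemma `idm_tens_jw_comp_V'` of the binor tensor model of Temperley–Lieb recoupling theory (conventions of KL94 §8.2, §9). [folklore] -/
theorem idm_tens_jw_comp_V' (hA : A ≠ 0) (f c e : ℕ) (hgf : Good A f) (hgc : Good A c) :
    (idm f ⊗ₘ jw A c) ⊚ V A f c e = V A f c e := idm_tens_jw_comp_V hA f c e hgf hgc

/-- Top absorption for the left tree: `(f_a ⊗ f_b ⊗ f_c) L = L`. [folklore] -/
theorem jw3_comp_treeL (hA : A ≠ 0) (a b c e f : ℕ) (hga : Good A a) (hgb : Good A b) (hgc : Good A c) (hgf : Good A f) :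
    (jw A a ⊗ₘ jw A b ⊗ₘ jw A c) ⊚ treeL A a b c e f = treeL A a b c e f := by
  rw [treeL, comp_assoc, tens_comp_tens, jw_tens_jw_comp_V hA a b f hga hgb, comp_idm,
    show (V A a b f ⊗ₘ jw A c :) = (V A a b f ⊗ₘ idm c :) ⊚ (idm f ⊗ₘ jw A c) from (tens_idm_comp_idm_tens _ _).symm,
    ← comp_assoc, idm_tens_jw_comp_V hA f c e hgf hgc]

end Mor


/-! ### The recoupling (F-move) modulo negligible morphisms -/

namespace Mor

variable (A : K)


variable {A} in
/-- Bookkeeping lemma `trAll_sum` of the binor tensor model of Temperley–Lieb recoupling theory (conventions of KL94 §8.2, §9). [folklore] -/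
theorem trAll_sum {ι : Type*} (S : Finset ι) (X : ι → Mor K n n) : trAll A (∑ i ∈ S, X i) = ∑ i ∈ S, trAll A (X i) := by
  induction S using Finset.cons_induction with
  | empty => rw [Finset.sum_empty, Finset.sum_empty, trAll_zero_mor]
  | cons a S ha ih => rw [Finset.sum_cons, Finset.sum_cons, trAll_add, ih]


variable {A}

/-- Bookkeeping lemma `PhiL_apply` of the binor tensor model of Temperley–Lieb recoupling theory (conventions of KL94 §8.2, §9). [folklore] -/
theorem PhiL_apply (a b c e f : ℕ) (X : Mor K (b + c) (b + c)) : PhiL A a b c e f X =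
    ((jw A a ⊗ₘ ((jw A b ⊗ₘ jw A c) ⊚ X)) :).cast (Nat.add_assoc a b c).symm (Nat.add_assoc a b c).symm ⊚
      treeL A a b c e f := rfl

/-- Bookkeeping lemma `Rmap_apply` of the binor tensor model of Temperley–Lieb recoupling theory (conventions of KL94 §8.2, §9). [folklore] -/
theorem Rmap_apply (a b c e J : ℕ) (w : Fin J → K) : Rmap A a b c e J w = ∑ i : Fin J, w i • treeR A a b c e i := rfl

/-- Bookkeeping lemma `PhiL_idm` of the binor tensor model of Temperley–Lieb recoupling theory (conventions of KL94 §8.2, §9). [folklore] -/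
theorem PhiL_idm (hA : A ≠ 0) (a b c e f : ℕ) (hga : Good A a) (hgb : Good A b) (hgc : Good A c) (hgf : Good A f) :
    PhiL A a b c e f (idm (b + c)) = treeL A a b c e f := by
  rw [PhiL_apply, comp_idm, tens_assoc, cast_cast, cast_eq_self, jw3_comp_treeL hA a b c e f hga hgb hgc hgf]

/-- Bookkeeping lemma `PhiL_neg` of the binor tensor model of Temperley–Lieb recoupling theory (conventions of KL94 §8.2, §9). [folklore] -/
theorem PhiL_neg (hA : A ≠ 0) (a b c e f : ℕ) {N : Mor K (b + c) (b + c)} (hN : N ∈ Neg A (b + c) (b + c)) :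
    PhiL A a b c e f N ∈ Neg A e (a + b + c) := by
  rw [PhiL_apply, tens_eq_comp_left (jw A a)]
  exact Neg.mem_comp hA (Neg.cast_mem (Neg.comp_mem (Neg.idm_tens_mem hA (Neg.comp_mem hN ((IsTL.jw b).tens (IsTL.jw c))) a)
    ((IsTL.jw a).tens_idm _)) _ _) (IsTL.treeL a b c e f)

/-- A generator `P f_j Q` of the decomposition of `𝟙_{b+c}` expands the left tree into a multiple of
the right tree `R_j`. [cite: KauffmanLins1994, §7.1 (proof of Thm 2)] -/
theorem PhiL_gen (hA : A ≠ 0) (a b c e f : ℕ) {j : ℕ} {P : Mor K j (b + c)} {Q : Mor K (b + c) j} (hP : IsTL A P)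
    (hQ : IsTL A Q) (hga : Good A a) (hgb : Good A b) (hgc : Good A c) (hgj : Good A j) (hge : Good A e) :
    ∃ κ : K, PhiL A a b c e f (P ⊚ jw A j ⊚ Q) = κ • treeR A a b c e j := by
  obtain ⟨κ, hκ⟩ := sandwich_V hA (a := b) (b := c) (c := j) hP hgb hgc hgj
  obtain ⟨κ', hκ'⟩ := sandwich_V hA (a := a) (b := j) (c := e)
    (X := (idm a ⊗ₘ Q :).cast (Nat.add_assoc a b c).symm rfl ⊚ treeL A a b c e f)
    ((((IsTL.idm a).tens hQ).cast _ _).comp _ (IsTL.treeL a b c e f)) hga hgj hge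
  refine ⟨κ * κ', ?_⟩
  rw [PhiL_apply, comp_assoc, comp_assoc, hκ, smul_comp, tens_smul, cast_smul, smul_comp, mul_smul]
  congr 1
  rw [← V_comp_jw hA b c j hgj, ← comp_assoc (V A b c j),
    show (jw A a ⊗ₘ (V A b c j ⊚ (jw A j ⊚ Q)) :) = (idm a ⊗ₘ V A b c j) ⊚ ((jw A a ⊗ₘ jw A j) ⊚ (idm a ⊗ₘ Q)) by
      rw [tens_comp_tens, tens_comp_tens, idm_comp, comp_idm],
    ← cast_comp_cast _ _ (Nat.add_assoc a b c).symm rfl (Nat.add_assoc a b c).symm, ← comp_assoc, comp_cast_right,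
    ← comp_assoc, ← treeL_comp_jw hA a b c e f hge, comp_assoc ((idm a ⊗ₘ Q :).cast _ _) (treeL A a b c e f) (jw A e),
    comp_assoc (jw A a ⊗ₘ jw A j) _ (jw A e), hκ', comp_smul, treeR]

/-- Bookkeeping lemma `Rmap_single` of the binor tensor model of Temperley–Lieb recoupling theory (conventions of KL94 §8.2, §9). [folklore] -/
theorem Rmap_single (a b c e J : ℕ) (j : Fin J) (r : K) :
    Rmap A a b c e J (Pi.single j r) = r • treeR A a b c e j := by
  rw [Rmap_apply, Finset.sum_eq_single j (fun i _ hi => by rw [Pi.single_eq_of_ne hi, zero_smul])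
    (fun h => absurd (Finset.mem_univ j) h), Pi.single_eq_same]

/-- **Recoupling, existence**: the left tree is a combination of right trees modulo negligible
morphisms, provided the identity of `b ⊗ c` decomposes through projectors of size `< J` modulo
negligibles. [cite: KauffmanLins1994, §7.1 Thm 2 (proof)] -/
theorem treeL_mem_range_sup_neg (hA : A ≠ 0) (a b c e f J : ℕ) (hgJ : Good A J) (hga : Good A a) (hgb : Good A b)
    (hgc : Good A c) (hgf : Good A f) (hge : Good A e)
    (hS : (idm (b + c) : Mor K (b + c) (b + c)) ∈ thruSpan A J (b + c) (b + c) ⊔ Neg A (b + c) (b + c)) :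
    treeL A a b c e f ∈ LinearMap.range (Rmap A a b c e J) ⊔ Neg A e (a + b + c) := by
  rw [← PhiL_idm hA a b c e f hga hgb hgc hgf]
  have key : thruSpan A J (b + c) (b + c) ⊔ Neg A (b + c) (b + c) ≤
      (LinearMap.range (Rmap A a b c e J) ⊔ Neg A e (a + b + c)).comap (PhiL A a b c e f) := by
    refine sup_le ?_ ?_
    · rw [thruSpan, Submodule.span_le]
      rintro _ ⟨j, P, Q, hj, hP, hQ, rfl⟩
      obtain ⟨κ, hκ⟩ := PhiL_gen hA a b c e f hP hQ hga hgb hgc (hgJ.mono hj.le) hge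
      simp only [Submodule.comap_coe, Set.mem_preimage, SetLike.mem_coe, hκ]
      refine Submodule.mem_sup_left ⟨Pi.single ⟨j, hj⟩ κ, ?_⟩
      rw [Rmap_single]
    · intro N hN
      exact Submodule.mem_sup_right (PhiL_neg hA a b c e f hN)
  exact key hS

/-- **The recoupling theorem modulo negligibles** with the Kauffman–Lins coefficients
`F_g = Tet Δ_g / (θ θ)`: `L_f ≡ Σ_{g<J} F_g R_g`. The hypothesis `hneg` says that right trees whose
bubble vanishes are themselves negligible (vacuous for generic `A`).
[cite: KauffmanLins1994, §7.1 Thm 2, §7.3 Prop. 11, §9.12, §9.14] -/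
theorem fmove (hA : A ≠ 0) (a b c e f J : ℕ) (hgJ : Good A J) (hga : Good A a) (hgb : Good A b) (hgc : Good A c)
    (hgf : Good A f) (hge : Good A (e + 1))
    (hS : (idm (b + c) : Mor K (b + c) (b + c)) ∈ thruSpan A J (b + c) (b + c) ⊔ Neg A (b + c) (b + c))
    (hneg : ∀ g : ℕ, g < J → thetaL A b c g * thetaL A a g e = 0 → treeR A a b c e g ∈ Neg A e (a + b + c)) :
    treeL A a b c e f - ∑ g ∈ Finset.range J, Fco A a b c e f g • treeR A a b c e g ∈ Neg A e (a + b + c) := by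
  have hge' : Good A e := hge.mono (Nat.le_succ e)
  obtain ⟨y, hy, z, hz, hyz⟩ := Submodule.mem_sup.mp (treeL_mem_range_sup_neg hA a b c e f J hgJ hga hgb hgc hgf hge' hS)
  obtain ⟨w, rfl⟩ := hy
  -- extraction of the coefficients by the dual trees
  have hcoef : ∀ h : Fin J, Tnet A a b c e f h = w h * (thetaL A b c h * thetaL A a h e / Delta A h) := by
    intro h
    have h1 := congrArg (fun X => trAll A (treeRd A a b c e h ⊚ X)) hyz
    rw [comp_add, trAll_add, Neg.trAll_eq_zero hz (IsTL.treeRd a b c e h), add_zero, Rmap_apply, comp_sum, trAll_sum] at h1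
    rw [Tnet, ← h1, Finset.sum_eq_single h (fun i _ hi => ?_) (fun hh => absurd (Finset.mem_univ h) hh), comp_smul,
      trAll_smul, trAll_treeRd_comp_treeR hA a b c e h h hga hgb hgc (hgJ.mono h.isLt) (hgJ.mono h.isLt.le) hge, if_pos rfl]
    rw [comp_smul, trAll_smul, trAll_treeRd_comp_treeR hA a b c e i h hga hgb hgc (hgJ.mono i.isLt) (hgJ.mono h.isLt.le) hge,
      if_neg (fun e => hi (Fin.ext e)), mul_zero]
  -- replace the extracted coefficients by `F`
  have hsum : treeL A a b c e f - ∑ g ∈ Finset.range J, Fco A a b c e f g • treeR A a b c e g =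
      z + ∑ i : Fin J, (w i - Fco A a b c e f i) • treeR A a b c e i := by
    rw [← Fin.sum_univ_eq_sum_range (fun g => Fco A a b c e f g • treeR A a b c e g), ← hyz, Rmap_apply,
      show (∑ i : Fin J, (w i - Fco A a b c e f i) • treeR A a b c e i) =
        ∑ i : Fin J, w i • treeR A a b c e i - ∑ i : Fin J, Fco A a b c e f i • treeR A a b c e i from by
          rw [← Finset.sum_sub_distrib]; exact Finset.sum_congr rfl (fun i _ => sub_smul _ _ _)]
    abel
  rw [hsum]
  refine Submodule.add_mem _ hz (Submodule.sum_mem _ (fun i _ => ?_))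
  by_cases hθ : thetaL A b c i * thetaL A a i e = 0
  · exact Submodule.smul_mem _ _ (hneg i i.isLt hθ)
  · have hw : w i = Fco A a b c e f i := by
      obtain ⟨hb', ha'⟩ := mul_ne_zero_iff.mp hθ
      rw [Fco, hcoef i]
      have hΔ : Delta A i ≠ 0 := hgJ i i.isLt
      field_simp
    rw [hw, sub_self, zero_smul]
    exact Submodule.zero_mem _

end Mor


/-! ### Vertices with vanishing θ are negligible -/

namespace Mor

variable {A : K}

/-- Bookkeeping lemma `trpm_V` of the binor tensor model of Temperley–Lieb recoupling theory (conventions of KL94 §8.2, §9). [folklore] -/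
theorem trpm_V (a b c : ℕ) : trpm (V A a b c) = ((-1 : K) ^ ((a + b - c) / 2)) • Vd A a b c := by
  by_cases h : Tri a b c
  · obtain ⟨x, z, y, rfl, rfl, rfl⟩ := h.decompose
    rw [V_eq, Vd_eq, trpm_vert, show (x + z + (y + z) - (x + y)) / 2 = z by omega]
  · rw [V_of_not_tri h, Vd_of_not_tri h, trpm_zero, smul_zero]

/-- Dual vertex uniqueness: `f_c Y (f_a ⊗ f_b) = κ V^∨(a,b;c)`. [cite: KauffmanLins1994, §9.9] -/
theorem sandwich_Vd (hA : A ≠ 0) {a b c : ℕ} {Y : Mor K (a + b) c} (hY : IsTL A Y) (hga : Good A a) (hgb : Good A b)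
    (hgc : Good A c) : ∃ κ : K, jw A c ⊚ Y ⊚ (jw A a ⊗ₘ jw A b) = κ • Vd A a b c := by
  obtain ⟨κ, hκ⟩ := sandwich_V hA hY.trpm hga hgb hgc
  have h := congrArg trpm hκ
  rw [trpm_comp, trpm_comp, trpm_tens, trpm_jw, trpm_jw, trpm_jw, trpm_trpm, trpm_smul, trpm_V, smul_smul,
    comp_assoc] at h
  exact ⟨_, h⟩

/-- A vertex whose θ vanishes is negligible. [cite: KauffmanLins1994, §6.3 Prop. 8, §7.1 (null vertices)] -/
theorem V_mem_neg_of_thetaL_eq_zero (hA : A ≠ 0) {a b c : ℕ} (hga : Good A a) (hgb : Good A b) (hgc : Good A c)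
    (hθ : thetaL A a b c = 0) : V A a b c ∈ Neg A c (a + b) := by
  refine Neg.mk (IsTL.V a b c) (fun Y hY => ?_)
  obtain ⟨κ, hκ⟩ := sandwich_Vd hA hY hga hgb hgc
  rw [← jw_tens_jw_comp_V hA a b c hga hgb, ← V_comp_jw hA a b c hgc, comp_assoc, comp_assoc,
    trAll_comp_comm hA ((hY.comp _ ((IsTL.jw a).tens (IsTL.jw b))).comp _ (IsTL.V a b c)), comp_assoc, comp_assoc,
    hκ, smul_comp, trAll_smul, ← thetaL, hθ, mul_zero]

/-- Right trees with a vanishing bubble are negligible. [folklore] -/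
theorem treeR_mem_neg (hA : A ≠ 0) {a b c e g : ℕ} (hga : Good A a) (hgb : Good A b) (hgc : Good A c) (hgg : Good A g)
    (hge : Good A e) (hθ : thetaL A b c g * thetaL A a g e = 0) : treeR A a b c e g ∈ Neg A e (a + b + c) := by
  rcases mul_eq_zero.mp hθ with h | h
  · rw [treeR]
    exact Neg.mem_comp hA (Neg.cast_mem (Neg.idm_tens_mem hA (V_mem_neg_of_thetaL_eq_zero hA hgb hgc hgg h) a) _ _)
      (IsTL.V a g e)
  · rw [treeR]
    exact Neg.comp_mem (V_mem_neg_of_thetaL_eq_zero hA hga hgg hge h) (((IsTL.idm a).tens (IsTL.V b c g)).cast _ _)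

/-- The recoupling theorem, `hneg` discharged: `L_f - Σ_{g<J} F_g R_g` is negligible.
[cite: KauffmanLins1994, §7.1 Thm 2, §9.14] -/
theorem fmove' (hA : A ≠ 0) (a b c e f J : ℕ) (hgJ : Good A J) (hga : Good A a) (hgb : Good A b) (hgc : Good A c)
    (hgf : Good A f) (hge : Good A (e + 1))
    (hS : (idm (b + c) : Mor K (b + c) (b + c)) ∈ thruSpan A J (b + c) (b + c) ⊔ Neg A (b + c) (b + c)) :
    treeL A a b c e f - ∑ g ∈ Finset.range J, Fco A a b c e f g • treeR A a b c e g ∈ Neg A e (a + b + c) :=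
  fmove hA a b c e f J hgJ hga hgb hgc hgf hge hS
    (fun _ hg hθ => treeR_mem_neg hA hga hgb hgc (hgJ.mono hg.le) (hge.mono (Nat.le_succ e)) hθ)

end Mor


/-! ### Four-leaf trees and the pentagon -/

namespace Mor

variable (A : K)


variable {A}

/-- Bookkeeping lemma `T1_eq` of the binor tensor model of Temperley–Lieb recoupling theory (conventions of KL94 §8.2, §9). [folklore] -/
theorem T1_eq (a b c d e f g : ℕ) : T1 A a b c d e f g = E1 A a b c d f ⊚ treeL A f c d e g := by
  rw [T1, E1, treeL, treeL, comp_assoc, tens_idm_comp_tens_idm]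

/-- Bookkeeping lemma `T2_eq` of the binor tensor model of Temperley–Lieb recoupling theory (conventions of KL94 §8.2, §9). [folklore] -/
theorem T2_eq (a b c d e h g : ℕ) : T2 A a b c d e h g = E2 A a b c d h ⊚ treeL A a h d e g := by
  rw [T2, E2, treeL, treeR, comp_assoc, tens_idm_comp_tens_idm]

/-- Bookkeeping lemma `E2_treeR` of the binor tensor model of Temperley–Lieb recoupling theory (conventions of KL94 §8.2, §9). [folklore] -/
theorem E2_treeR (a b c d e h k : ℕ) : E2 A a b c d h ⊚ treeR A a h d e k = T3 A a b c d e h k := by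
  rw [E2, treeR, T3, comp_assoc]
  congr 1
  apply ext'
  simp only [comp_val, cast_val, tens_val, idm_val, treeL]
  rw [show a + b + c = a + (b + c) by omega, ← tensR_assoc (n := a) (m := a) (n' := b + c) (m' := h),
    show a + h + d = a + (h + d) by omega, compR_tensR_tensR (RespC.idR a) (RespR.idR a), idR_compR (RespR.idR a)]

end Mor


namespace Mor

variable {A : K}

/-- Bookkeeping lemma `E3L_apply` of the binor tensor model of Temperley–Lieb recoupling theory (conventions of KL94 §8.2, §9). [folklore] -/
theorem E3L_apply (a b c d e k : ℕ) (X : Mor K k (b + c + d)) :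
    E3L A a b c d e k X = (idm a ⊗ₘ X :).cast rfl (by omega) ⊚ V A a k e := rfl

/-- Bookkeeping lemma `T3_eq` of the binor tensor model of Temperley–Lieb recoupling theory (conventions of KL94 §8.2, §9). [folklore] -/
theorem T3_eq (a b c d e h k : ℕ) : T3 A a b c d e h k = E3L A a b c d e k (treeL A b c d k h) := rfl
/-- Bookkeeping lemma `T4_eq` of the binor tensor model of Temperley–Lieb recoupling theory (conventions of KL94 §8.2, §9). [folklore] -/
theorem T4_eq (a b c d e l k : ℕ) : T4 A a b c d e l k = E3L A a b c d e k (treeR A b c d k l) := rfl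

/-- Bookkeeping lemma `E1_treeR` of the binor tensor model of Temperley–Lieb recoupling theory (conventions of KL94 §8.2, §9). [folklore] -/
theorem E1_treeR (a b c d e f l : ℕ) : E1 A a b c d f ⊚ treeR A f c d e l = T5 A a b c d e f l := by
  rw [E1, treeR, T5, treeL, comp_assoc, comp_assoc]
  congr 1
  apply ext'
  simp only [comp_val, cast_val, tens_val, idm_val]
  rw [← tensR_assoc (X := (V A a b f).val), tensR_idR_idR, show f + c + d = f + (c + d) by omega,
    compR_tensR_tensR (V A a b f).respC (RespR.idR f), compR_idR (V A a b f).respC, idR_compR (V A c d l).respR,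
    compR_tensR_tensR (RespC.idR (a + b)) (V A a b f).respR, idR_compR (V A a b f).respR, compR_idR (V A c d l).respC]

/-- Bookkeeping lemma `E5_treeR` of the binor tensor model of Temperley–Lieb recoupling theory (conventions of KL94 §8.2, §9). [folklore] -/
theorem E5_treeR (a b c d e l k : ℕ) : E5 A a b c d l ⊚ treeR A a b l e k = T4 A a b c d e l k := by
  rw [E5, treeR, T4, treeR, comp_assoc]
  congr 1
  apply ext'
  simp only [comp_val, cast_val, tens_val, idm_val]
  rw [← tensR_idR_idR a b, ← tensR_assoc (X := idR a) (n := a) (m := a) (n' := b) (m' := b),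
    show a + b + l = a + (b + l) by omega, compR_tensR_tensR (RespC.idR a) (RespR.idR a), idR_compR (RespR.idR a)]

/-- Bookkeeping lemma `E3L_neg` of the binor tensor model of Temperley–Lieb recoupling theory (conventions of KL94 §8.2, §9). [folklore] -/
theorem E3L_neg (hA : A ≠ 0) (a b c d e k : ℕ) {N : Mor K k (b + c + d)} (hN : N ∈ Neg A k (b + c + d)) :
    E3L A a b c d e k N ∈ Neg A e (a + b + c + d) := by
  rw [E3L_apply]
  exact Neg.mem_comp hA (Neg.cast_mem (Neg.idm_tens_mem hA hN a) _ _) (IsTL.V a k e)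

/-- Bookkeeping lemma `E1` of the binor tensor model of Temperley–Lieb recoupling theory (conventions of KL94 §8.2, §9). [folklore] -/
theorem _root_.Literature.RepresentationTheory.ModularTensorCategories.TemperleyLieb.IsTL.E1 (a b c d f : ℕ) : IsTL A (E1 A a b c d f) :=
  ((IsTL.V a b f).tens_idm c).tens_idm d

/-- Bookkeeping lemma `E2` of the binor tensor model of Temperley–Lieb recoupling theory (conventions of KL94 §8.2, §9). [folklore] -/
theorem _root_.Literature.RepresentationTheory.ModularTensorCategories.TemperleyLieb.IsTL.E2 (a b c d h : ℕ) : IsTL A (E2 A a b c d h) :=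
  (((IsTL.idm a).tens (IsTL.V b c h)).cast _ _).tens_idm d

/-- Bookkeeping lemma `E5` of the binor tensor model of Temperley–Lieb recoupling theory (conventions of KL94 §8.2, §9). [folklore] -/
theorem _root_.Literature.RepresentationTheory.ModularTensorCategories.TemperleyLieb.IsTL.E5 (a b c d l : ℕ) : IsTL A (E5 A a b c d l) :=
  ((IsTL.idm _).tens (IsTL.V c d l)).cast _ _

/-- Bookkeeping lemma `T4d` of the binor tensor model of Temperley–Lieb recoupling theory (conventions of KL94 §8.2, §9). [folklore] -/
theorem _root_.Literature.RepresentationTheory.ModularTensorCategories.TemperleyLieb.IsTL.T4d (a b c d e l k : ℕ) :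
    IsTL A (T4d A a b c d e l k) :=
  (IsTL.Vd a k e).comp _ (((IsTL.idm a).tens (IsTL.treeRd b c d k l)).cast _ _)

/-- Off-diagonal tree bubble in the bottom label. [folklore] -/
theorem treeRd_comp_treeR_ne (hA : A ≠ 0) {a b c e e' g h : ℕ} (he : e ≠ e') (hge : Good A e) (hge' : Good A e')
    (hgb : Good A b) (hgc : Good A c) (hgg : Good A (g + 1)) (hgh : Good A h) (hga : Good A a) :
    treeRd A a b c e' h ⊚ treeR A a b c e g = 0 := by
  rw [treeRd, treeR, comp_assoc, ← comp_assoc (Vd A a h e'), cast_comp_cast, idm_tens_comp_idm_tens, cast_rfl]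
  by_cases hgh' : g = h
  · subst hgh'
    rw [Vd_comp_V_self hA b c g hgb hgc hgg, tens_smul, comp_smul, smul_comp, ← comp_assoc,
      idm_tens_jw_comp_V hA a g e hga (hgg.mono (Nat.le_succ g)), Vd_comp_V_ne hA he hge hge', smul_zero]
  · rw [Vd_comp_V_ne hA hgh' (hgg.mono (Nat.le_succ g)) hgh, tens_zero, comp_zero, zero_comp]

/-- **The pairing of the final basis with its duals**:
`tr(T4^∨(l',k') T4(l,k)) = δδ θ(c,d,l)θ(b,l,k)θ(a,k,e)/(Δ_l Δ_k)`. [folklore] -/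
theorem trAll_T4d_T4 (hA : A ≠ 0) (a b c d e l k l' k' : ℕ) (hga : Good A a) (hgb : Good A b) (hgc : Good A c)
    (hgd : Good A d) (hgl : Good A (l + 1)) (hgl' : Good A l') (hgk : Good A (k + 1)) (hgk' : Good A (k' + 1))
    (hge : Good A (e + 1)) :
    trAll A (T4d A a b c d e l' k' ⊚ T4 A a b c d e l k) =
      if l = l' ∧ k = k' then thetaL A c d l * thetaL A b l k * thetaL A a k e / (Delta A l * Delta A k) else 0 := by
  rw [T4d, T4, comp_assoc, ← comp_assoc (Vd A a k' e), cast_comp_cast, idm_tens_comp_idm_tens, cast_rfl]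
  by_cases hk : k = k'
  · subst hk
    rw [treeRd_comp_treeR hA b c d k l l' hgb hgc hgd hgl hgl' hgk]
    by_cases hl : l = l'
    · subst hl
      rw [if_pos rfl, if_pos ⟨rfl, rfl⟩, tens_smul, comp_smul, smul_comp, ← comp_assoc,
        idm_tens_jw_comp_V hA a k e hga (hgk.mono (Nat.le_succ k)), Vd_comp_V_self hA a k e hga (hgk.mono (Nat.le_succ k)) hge,
        smul_smul, trAll_smul, trAll_jw hA e (hge.mono (Nat.le_succ e))]
      field_simp [hge e (Nat.lt_succ_self e)]
    · rw [if_neg hl, if_neg (fun h => hl h.1), tens_zero, comp_zero, zero_comp, trAll_zero_mor]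
  · rw [treeRd_comp_treeR_ne hA hk (hgk.mono (Nat.le_succ k)) (hgk'.mono (Nat.le_succ k')) hgc hgd hgl hgl' hgb,
      tens_zero, comp_zero, zero_comp, trAll_zero_mor, if_neg (fun h => hk h.2)]

end Mor


namespace Mor

variable {A : K}

/-- Bookkeeping lemma `Fco_eq_zero_of_left` of the binor tensor model of Temperley–Lieb recoupling theory (conventions of KL94 §8.2, §9). [folklore] -/
theorem Fco_eq_zero_of_left {a b c e f g : ℕ} (h : thetaL A a g e = 0) : Fco A a b c e f g = 0 := by
  rw [Fco, h, zero_mul, div_zero]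

/-- Bookkeeping lemma `Fco_eq_zero_of_right` of the binor tensor model of Temperley–Lieb recoupling theory (conventions of KL94 §8.2, §9). [folklore] -/
theorem Fco_eq_zero_of_right {a b c e f g : ℕ} (h : thetaL A b c g = 0) : Fco A a b c e f g = 0 := by
  rw [Fco, h, mul_zero, div_zero]

/-- Transport of a recoupling congruence `X - Σ c_g Y_g ∈ Neg` along a Neg-preserving linear map. [folklore] -/
theorem map_fmove {M₁ M₂ : Type*} [AddCommGroup M₁] [Module K M₁] [AddCommGroup M₂] [Module K M₂]
    (Φ : M₁ →ₗ[K] M₂) (N₁ : Submodule K M₁) (N₂ : Submodule K M₂) (hΦ : ∀ x ∈ N₁, Φ x ∈ N₂)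
    {X : M₁} {S : Finset ℕ} {c : ℕ → K} {Y : ℕ → M₁} (h : X - ∑ g ∈ S, c g • Y g ∈ N₁) :
    Φ X - ∑ g ∈ S, c g • Φ (Y g) ∈ N₂ := by
  have := hΦ _ h
  rwa [map_sub, map_sum, Finset.sum_congr rfl (fun g _ => map_smul Φ (c g) (Y g))] at this

section Pentagon

variable (hA : A ≠ 0) {a b c d e f g J : ℕ} (hgJ : Good A J) (ha : a < J) (hb : b < J) (hc : c < J) (hd : d < J)
  (hf : f < J) (hg : g < J) (he : e + 1 ≤ J)
  (hS : ∀ n : ℕ, n ≤ b + c + d → (idm n : Mor K n n) ∈ thruSpan A J n n ⊔ Neg A n n)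

include hA hgJ ha hb hc hd hf hg he hS

omit hd he in
/-- Move A1: `T1 ≡ Σ_h F^{abc}_{g;fh} T2(h)`. [folklore] -/
theorem moveA1 : T1 A a b c d e f g - ∑ h ∈ Finset.range J, Fco A a b c g f h • T2 A a b c d e h g ∈
    Neg A e (a + b + c + d) := by
  have h0 := fmove' hA a b c g f J hgJ (hgJ.mono ha.le) (hgJ.mono hb.le) (hgJ.mono hc.le) (hgJ.mono hf.le)
    (hgJ.mono (by omega)) (hS (b + c) (by omega))
  have := map_fmove ((compRightL (V A g d e)).comp (tensIdmL _ _ d)) (Neg A g (a + b + c)) (Neg A e (a + b + c + d))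
    (fun x hx => Neg.mem_comp hA (Neg.tens_idm_mem hx d) (IsTL.V g d e)) h0
  simpa [T1, T2] using this

omit hb hc hf in
/-- Move A2: `T2(h) ≡ Σ_k F^{ahd}_{e;gk} T3(h,k)` for admissible `(b,c,h)`. [folklore] -/
theorem moveA2 {h : ℕ} (hh : h < J) (hT : Tri b c h) :
    T2 A a b c d e h g - ∑ k ∈ Finset.range J, Fco A a h d e g k • T3 A a b c d e h k ∈ Neg A e (a + b + c + d) := by
  have hhd : h + d ≤ b + c + d := by unfold Tri at hT; omega
  have h0 := fmove' hA a h d e g J hgJ (hgJ.mono ha.le) (hgJ.mono hh.le) (hgJ.mono hd.le) (hgJ.mono hg.le)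
    (hgJ.mono he) (hS (h + d) hhd)
  have := map_fmove (compLeftL (E2 A a b c d h)) (Neg A e (a + h + d)) (Neg A e (a + b + c + d))
    (fun x hx => Neg.comp_mem hx (IsTL.E2 a b c d h)) h0
  simpa [T2_eq, E2_treeR] using this

omit ha hf hg he in
/-- Move A3: `T3(h,k) ≡ Σ_l F^{bcd}_{k;hl} T4(l,k)`. [folklore] -/
theorem moveA3 {h k : ℕ} (hh : h < J) (hk : k < J) :
    T3 A a b c d e h k - ∑ l ∈ Finset.range J, Fco A b c d k h l • T4 A a b c d e l k ∈ Neg A e (a + b + c + d) := by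
  have h0 := fmove' hA b c d k h J hgJ (hgJ.mono hb.le) (hgJ.mono hc.le) (hgJ.mono hd.le) (hgJ.mono hh.le)
    (hgJ.mono (by omega)) (hS (c + d) (by omega))
  have := map_fmove (E3L A a b c d e k) (Neg A k (b + c + d)) (Neg A e (a + b + c + d))
    (fun x hx => E3L_neg hA a b c d e k hx) h0
  simpa [T3_eq, T4_eq] using this

omit ha hb in
/-- Move B1: `T1 ≡ Σ_l F^{fcd}_{e;gl} T5(l)`. [folklore] -/
theorem moveB1 : T1 A a b c d e f g - ∑ l ∈ Finset.range J, Fco A f c d e g l • T5 A a b c d e f l ∈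
    Neg A e (a + b + c + d) := by
  have h0 := fmove' hA f c d e g J hgJ (hgJ.mono hf.le) (hgJ.mono hc.le) (hgJ.mono hd.le) (hgJ.mono hg.le)
    (hgJ.mono he) (hS (c + d) (by omega))
  have := map_fmove (compLeftL (E1 A a b c d f)) (Neg A e (f + c + d)) (Neg A e (a + b + c + d))
    (fun x hx => Neg.comp_mem hx (IsTL.E1 a b c d f)) h0
  simpa [T1_eq, E1_treeR] using this

omit hc hd hg in
/-- Move B2: `T5(l) ≡ Σ_k F^{abl}_{e;fk} T4(l,k)` for admissible `(c,d,l)`. [folklore] -/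
theorem moveB2 {l : ℕ} (hl : l < J) (hT : Tri c d l) :
    T5 A a b c d e f l - ∑ k ∈ Finset.range J, Fco A a b l e f k • T4 A a b c d e l k ∈ Neg A e (a + b + c + d) := by
  have hbl : b + l ≤ b + c + d := by unfold Tri at hT; omega
  have h0 := fmove' hA a b l e f J hgJ (hgJ.mono ha.le) (hgJ.mono hb.le) (hgJ.mono hl.le) (hgJ.mono hf.le)
    (hgJ.mono he) (hS (b + l) hbl)
  have := map_fmove (compLeftL (E5 A a b c d l)) (Neg A e (a + b + l)) (Neg A e (a + b + c + d))
    (fun x hx => Neg.comp_mem hx (IsTL.E5 a b c d l)) h0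
  rw [show T5 A a b c d e f l = E5 A a b c d l ⊚ treeL A a b l e f from rfl]
  simpa [E5_treeR] using this

/-- **The pentagon (Biedenharn–Elliott) identity for the Kauffman–Lins recoupling coefficients**
`F^{fcd}_{e;gl} F^{abl}_{e;fk} = Σ_h F^{abc}_{g;fh} F^{ahd}_{e;gk} F^{bcd}_{k;hl}`, derived from the two ways of
recoupling `(((ab)c)d)` to `(a(b(cd)))` modulo negligible morphisms and the nondegenerate pairing of the
final tree basis with its duals. [cite: KauffmanLins1994, §7.3 Prop. 10, §9.14] -/
theorem pentagon_Fco (k' l' : ℕ) (hk' : k' < J) (hl' : l' < J) :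
    Fco A f c d e g l' * Fco A a b l' e f k' =
      ∑ h ∈ Finset.range J, Fco A a b c g f h * Fco A a h d e g k' * Fco A b c d k' h l' := by
  -- path A
  have m1 := moveA1 (e := e) hA hgJ ha hb hc hf hg hS
  have m2 : ∑ h ∈ Finset.range J, Fco A a b c g f h •
      (T2 A a b c d e h g - ∑ k ∈ Finset.range J, Fco A a h d e g k • T3 A a b c d e h k) ∈ Neg A e (a + b + c + d) := by
    refine Submodule.sum_mem _ (fun h hh => ?_)
    by_cases hT : Tri b c h
    · exact Submodule.smul_mem _ _ (moveA2 hA hgJ ha hd hg he hS (Finset.mem_range.mp hh) hT)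
    · rw [Fco_eq_zero_of_right (thetaL_of_not_tri hT), zero_smul]; exact Submodule.zero_mem _
  have m3 : ∑ h ∈ Finset.range J, ∑ k ∈ Finset.range J, (Fco A a b c g f h * Fco A a h d e g k) •
      (T3 A a b c d e h k - ∑ l ∈ Finset.range J, Fco A b c d k h l • T4 A a b c d e l k) ∈ Neg A e (a + b + c + d) :=
    Submodule.sum_mem _ (fun h hh => Submodule.sum_mem _ (fun k hk => Submodule.smul_mem _ _
      (moveA3 hA hgJ hb hc hd hS (Finset.mem_range.mp hh) (Finset.mem_range.mp hk))))
  have pathA : T1 A a b c d e f g - ∑ h ∈ Finset.range J, ∑ k ∈ Finset.range J, ∑ l ∈ Finset.range J,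
      (Fco A a b c g f h * Fco A a h d e g k * Fco A b c d k h l) • T4 A a b c d e l k ∈ Neg A e (a + b + c + d) := by
    convert Submodule.add_mem _ (Submodule.add_mem _ m1 m2) m3 using 1
    simp only [smul_sub, Finset.smul_sum, Finset.sum_sub_distrib, smul_smul]
    abel
  -- path B
  have n1 := moveB1 (a := a) (b := b) hA hgJ hc hd hf hg he hS
  have n2 : ∑ l ∈ Finset.range J, Fco A f c d e g l •
      (T5 A a b c d e f l - ∑ k ∈ Finset.range J, Fco A a b l e f k • T4 A a b c d e l k) ∈ Neg A e (a + b + c + d) := by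
    refine Submodule.sum_mem _ (fun l hl => ?_)
    by_cases hT : Tri c d l
    · exact Submodule.smul_mem _ _ (moveB2 hA hgJ ha hb hf he hS (Finset.mem_range.mp hl) hT)
    · rw [Fco_eq_zero_of_right (thetaL_of_not_tri hT), zero_smul]; exact Submodule.zero_mem _
  have pathB : T1 A a b c d e f g - ∑ l ∈ Finset.range J, ∑ k ∈ Finset.range J,
      (Fco A f c d e g l * Fco A a b l e f k) • T4 A a b c d e l k ∈ Neg A e (a + b + c + d) := by
    convert Submodule.add_mem _ n1 n2 using 1
    simp only [smul_sub, Finset.smul_sum, Finset.sum_sub_distrib, smul_smul]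
    abel
  -- the difference of the two expansions
  set C : ℕ → ℕ → K := fun l k => (∑ h ∈ Finset.range J, Fco A a b c g f h * Fco A a h d e g k * Fco A b c d k h l) -
    Fco A f c d e g l * Fco A a b l e f k with hC
  have hD : ∑ l ∈ Finset.range J, ∑ k ∈ Finset.range J, C l k • T4 A a b c d e l k ∈ Neg A e (a + b + c + d) := by
    convert Submodule.sub_mem _ pathB pathA using 1
    simp only [hC, sub_smul, Finset.sum_smul, Finset.sum_sub_distrib]
    rw [Finset.sum_comm (s := Finset.range J) (t := Finset.range J)
      (f := fun h k => ∑ l ∈ Finset.range J, (Fco A a b c g f h * Fco A a h d e g k * Fco A b c d k h l) • T4 A a b c d e l k),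
      Finset.sum_congr rfl (fun k _ => Finset.sum_comm (s := Finset.range J) (t := Finset.range J)
        (f := fun h l => (Fco A a b c g f h * Fco A a h d e g k * Fco A b c d k h l) • T4 A a b c d e l k)),
      Finset.sum_comm (s := Finset.range J) (t := Finset.range J)
        (f := fun k l => ∑ h ∈ Finset.range J, (Fco A a b c g f h * Fco A a h d e g k * Fco A b c d k h l) • T4 A a b c d e l k)]
    abel
  -- extraction of the `(l', k')` coefficient
  have htr := Neg.trAll_eq_zero hD (IsTL.T4d a b c d e l' k')
  rw [comp_sum, trAll_sum] at htr
  have htr' : ∑ l ∈ Finset.range J, ∑ k ∈ Finset.range J,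
      C l k * trAll A (T4d A a b c d e l' k' ⊚ T4 A a b c d e l k) = 0 := by
    rw [← htr]
    refine Finset.sum_congr rfl (fun l _ => ?_)
    rw [comp_sum, trAll_sum]
    exact Finset.sum_congr rfl (fun k _ => by rw [comp_smul, trAll_smul])
  have hpair : ∀ l ∈ Finset.range J, ∀ k ∈ Finset.range J, trAll A (T4d A a b c d e l' k' ⊚ T4 A a b c d e l k) =
      if l = l' ∧ k = k' then thetaL A c d l * thetaL A b l k * thetaL A a k e / (Delta A l * Delta A k) else 0 :=
    fun l hl k hk => trAll_T4d_T4 hA a b c d e l k l' k' (hgJ.mono ha.le) (hgJ.mono hb.le) (hgJ.mono hc.le)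
      (hgJ.mono hd.le) (hgJ.mono (Finset.mem_range.mp hl)) (hgJ.mono hl'.le) (hgJ.mono (Finset.mem_range.mp hk))
      (hgJ.mono hk') (hgJ.mono he)
  rw [Finset.sum_eq_single l' (fun l hl hll' => Finset.sum_eq_zero (fun k hk => by
      rw [hpair l hl k hk, if_neg (fun h => hll' h.1), mul_zero])) (fun h => absurd (Finset.mem_range.mpr hl') h),
    Finset.sum_eq_single k' (fun k hk hkk' => by
      rw [hpair l' (Finset.mem_range.mpr hl') k hk, if_neg (fun h => hkk' h.2), mul_zero])
      (fun h => absurd (Finset.mem_range.mpr hk') h),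
    hpair l' (Finset.mem_range.mpr hl') k' (Finset.mem_range.mpr hk'), if_pos ⟨rfl, rfl⟩] at htr'
  -- conclusion
  by_cases hθ : thetaL A c d l' * thetaL A b l' k' * thetaL A a k' e = 0
  · -- both sides vanish
    rcases mul_eq_zero.mp hθ with h2 | h1
    · rcases mul_eq_zero.mp h2 with h3 | h4
      · rw [Fco_eq_zero_of_right (A := A) (a := f) (b := c) (c := d) (e := e) (f := g) h3, zero_mul]
        refine (Finset.sum_eq_zero (fun h _ => ?_)).symm
        rw [Fco_eq_zero_of_right (A := A) (a := b) (b := c) (c := d) (e := k') (f := h) h3, mul_zero]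
      · rw [Fco_eq_zero_of_right (A := A) (a := a) (b := b) (c := l') (e := e) (f := f) h4, mul_zero]
        refine (Finset.sum_eq_zero (fun h _ => ?_)).symm
        rw [Fco_eq_zero_of_left (A := A) (a := b) (b := c) (c := d) (e := k') (f := h) h4, mul_zero]
    · rw [Fco_eq_zero_of_left (A := A) (a := a) (b := b) (c := l') (e := e) (f := f) h1, mul_zero]
      refine (Finset.sum_eq_zero (fun h _ => ?_)).symm
      rw [Fco_eq_zero_of_left (A := A) (a := a) (b := h) (c := d) (e := e) (f := g) h1, mul_zero, zero_mul]
  · have hΔ : Delta A l' * Delta A k' ≠ 0 := mul_ne_zero (hgJ l' hl') (hgJ k' hk')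
    have hC0 : C l' k' = 0 := by
      rcases mul_eq_zero.mp htr' with h0 | h0
      · exact h0
      · exact absurd h0 (div_ne_zero hθ hΔ)
    rw [hC] at hC0
    exact (sub_eq_zero.mp hC0).symm

end Pentagon

end Mor



/-! ### Bending the last strand of a projector: `(f_{n+1} ⊗ 𝟙)(𝟙_n ⊗ ∪) f_n = Σ_s (-1)^s (Δ_{n-s}/Δ_n) ∪_{n-s} f_n` -/

namespace Mor

variable {A : K}

/-- One Wenzl step for the bent strand (raw): `((P U P) ⊗ 𝟙) ∪_{p+1} = ((f_{p+1} ⊗ 𝟙)(𝟙_p ⊗ ∪) ⊗ 𝟙) f_{p+1}`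
on `p + 1` strands, for a box `J` on `p + 1` strands. [folklore] -/
theorem bend_step_raw (hA : A ≠ 0) (p : ℕ) (J : Raw K) (hJr : RespR (p + 1) J) (hJc : RespC (p + 1) J) :
    compR (p + 1 + 0 + 2) (tensR (p + 2) (p + 2)
      (compR (p + 2) (compR (p + 2) (tensR (p + 1) (p + 1) J (idR 1)) (tensR p p (idR p) (U A).val))
        (tensR (p + 1) (p + 1) J (idR 1))) (idR 1)) (cupAt A (p + 1 + 0) (p + 1)).val =
    compR (p + 0 + 1) (tensR (p + 2) (p + 0)
      (compR (p + 2) (tensR (p + 1) (p + 1) J (idR 1)) (tensR p p (idR p) (cupR A))) (idR 1)) J := by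
  have hPc : RespC (p + 2) (tensR (p + 1) (p + 1) J (idR 1)) := hJc.tensR (RespC.idR 1) (p + 1)
  have hPr : RespR (p + 2) (tensR (p + 1) (p + 1) J (idR 1)) := hJr.tensR (RespR.idR 1) (p + 1)
  have hC2c : RespC (p + 2) (tensR p p (idR p) (capR A)) := (RespC.idR p).tensR (RespC.capR A) p
  have hQ1c : RespC (p + 0) (compR (p + 2) (tensR (p + 1) (p + 1) J (idR 1)) (tensR p p (idR p) (cupR A))) :=
    RespC.compR _ _ ((RespC.idR p).tensR (RespC.cupR A 0) p)
  have hQ2r : RespR (p + 0) (compR (p + 2) (tensR p p (idR p) (capR A)) (tensR (p + 1) (p + 1) J (idR 1))) :=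
    RespR.compR _ ((RespR.idR p).tensR (RespR.capR A 0) p) _
  rw [U_val', idR_tensR_compR, compR_assoc (tensR (p + 1) (p + 1) J (idR 1)), ← compR_assoc,
    tensR_compR_idR 1 hQ1c hQ2r, ← compR_assoc, tensR_compR_idR 1 hC2c hPr, ← compR_assoc,
    hook_low_raw hA p 0 J hJr hJc, tensR_idR_zero]

/-- **Bending the last strand**: `((f_{n+1} ⊗ 𝟙)(𝟙_n ⊗ ∪) ⊗ 𝟙_t) f_{t+n} = Σ_{s≤n} (-1)^s (Δ_{n-s}/Δ_n) ∪_{n-s} f_{t+n}`.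
(The last strand of `f_{n+1}` turned down; expanding the projector recursively along that strand.)
[cite: KauffmanLins1994, §3.3 (expansion of the projector), §9.6] -/
theorem bend_jw (hA : A ≠ 0) : ∀ (n t : ℕ), Good A (n + t + 1) →
    ((((jw A (n + 1) ⊗ₘ idm 1 :) ⊚ (idm n ⊗ₘ cup A :)) ⊗ₘ idm t :).cast (show n + 0 + t = t + n by omega)
        (show n + 1 + 1 + t = t + n + 2 by omega)) ⊚ jw A (t + n) =
      ∑ s ∈ Finset.range (n + 1), ((-1 : K) ^ s * (Delta A (n - s) / Delta A n)) • (cupAt A (t + n) (n - s) ⊚ jw A (t + n)) := by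
  intro n
  induction n with
  | zero =>
    intro t hg
    rw [Finset.sum_range_one, pow_zero, one_mul, Nat.sub_zero, div_self (hg 0 (by omega)), one_smul, jw_one]
    apply ext'
    simp only [comp_val, cast_val, tens_val, idm_val, cup_val, Nat.add_zero]
    rw [tensR_idR_idR, tensR_zero_zero_idR_zero, idR_compR (RespR.cupR A), cupAt_val A (Nat.zero_le t), Nat.sub_zero,
      block_zero_left]
  | succ n IH =>
    intro t hg
    have IH' := congrArg Mor.val (IH (t + 1) (hg.mono (by omega)))
    have hstep := bend_step_raw hA n (jw A (n + 1)).val (jw A (n + 1)).respR (jw A (n + 1)).respC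
    have habs := congrArg Mor.val (jw_absorb_left' hA (k := n + 1) t (hg.mono (by omega)))
    have habs' := congrArg Mor.val (jw_absorb_left' hA (k := n + 1) (t + 1) (hg.mono (by omega)))
    simp only [comp_val, cast_val, tens_val, idm_val, cup_val, sum_val, smul_val] at IH' habs habs'
    rw [jw_succ_succ A n, sub_tens, smul_tens, sub_comp, smul_comp, sub_tens, smul_tens, cast_sub, cast_smul, sub_comp,
      smul_comp, Finset.sum_range_succ', pow_zero, one_mul, Nat.sub_zero, div_self (hg (n + 1) (by omega)), one_smul]
    apply ext'
    simp only [comp_val, cast_val, tens_val, idm_val, cup_val, sum_val, smul_val, sub_val, add_val]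
    have hΔn : Delta A n ≠ 0 := hg n (by omega)
    have hΔn1 : Delta A (n + 1) ≠ 0 := hg (n + 1) (by omega)
    -- align the auxiliary facts with the goal
    rw [cupAt_val A (show n + 1 ≤ n + 1 + 0 by omega), show n + 1 + 0 - (n + 1) = 0 by omega] at hstep
    unfold block at hstep
    rw [tensR_idR_zero] at hstep
    rw [jw_val_congr (show n + 1 + t = t + (n + 1) by omega)] at habs
    simp only [show n + 1 + t = t + (n + 1) by omega] at habs
    rw [jw_val_congr (show t + 1 + n = t + (n + 1) by omega)] at IH'
    simp only [show t + 1 + n = t + (n + 1) by omega, cupAt_val_congr A (show t + 1 + n = t + (n + 1) by omega) rfl,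
      Nat.add_zero] at IH'
    -- the first term is the `s = 0` cup
    have eL : compR (n + 1 + 1 + 1)
        (tensR (n + 1 + 1) (n + 1 + 1) (tensR (n + 1) (n + 1) (jw A (n + 1)).val (idR 1)) (idR 1))
        (tensR (n + 1) (n + 1) (idR (n + 1)) (cupR A)) = tensR (n + 1) (n + 1) (jw A (n + 1)).val (cupR A) := by
      rw [← tensR_assoc (X := (jw A (n + 1)).val) (n := n + 1) (m := n + 1) (n' := 1) (m' := 1), tensR_idR_idR]
      show compR (n + 1 + 2) (tensR (n + 1) (n + 1) (jw A (n + 1)).val (idR 2)) _ = _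
      rw [compR_tensR_tensR (jw A (n + 1)).respC (RespR.idR (n + 1)), compR_idR (jw A (n + 1)).respC,
        idR_compR (RespR.cupR A)]
    have eR : compR (n + 1 + 0) (tensR (n + 1) (n + 1) (idR (n + 1)) (cupR A)) (jw A (n + 1)).val =
        tensR (n + 1) (n + 1) (jw A (n + 1)).val (cupR A) := by
      conv_lhs => rw [← tensR_idR_zero (n := n + 1) (m := n + 1) (jw A (n + 1)).val]
      rw [compR_tensR_tensR (RespC.idR (n + 1)) (jw A (n + 1)).respR, idR_compR (jw A (n + 1)).respR,
        compR_idR (RespC.cupR A 0)]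
    have hT1 := eL.trans eR.symm
    have hCc : RespC (n + 1) (tensR (n + 1) (n + 1) (idR (n + 1)) (cupR A)) := by
      simpa using (RespC.idR (K := K) (n + 1)).tensR (RespC.cupR A 0) (n + 1)
    rw [hT1, tensR_compR_idR t hCc (jw A (n + 1)).respR, ← compR_assoc,
      show n + 1 + 0 + t = t + (n + 1) by omega, habs, cupAt_val A (show n + 1 ≤ t + (n + 1) by omega),
      show t + (n + 1) - (n + 1) = t by omega]
    -- the second term: one Wenzl step, then the induction hypothesis
    have hQ1c : RespC (n + 0 + 1) (tensR (n + 2) (n + 0)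
        (compR (n + 2) (tensR (n + 1) (n + 1) (jw A (n + 1)).val (idR 1)) (tensR n n (idR n) (cupR A))) (idR 1)) :=
      (RespC.compR _ _ ((RespC.idR n).tensR (RespC.cupR A 0) n)).tensR (RespC.idR 1) _
    rw [show compR (n + 1 + 1 + 1) (tensR (n + 1 + 1) (n + 1 + 1)
        (compR (n + 2) (compR (n + 1 + 1) (tensR (n + 1) (n + 1) (jw A (n + 1)).val (idR 1))
          (tensR n n (idR n) (U A).val)) (tensR (n + 1) (n + 1) (jw A (n + 1)).val (idR 1))) (idR 1))
        (tensR (n + 1) (n + 1) (idR (n + 1)) (cupR A)) = _ from hstep,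
      tensR_compR_idR t hQ1c (jw A (n + 1)).respR, ← compR_assoc, show n + 0 + 1 + t = t + (n + 1) by omega, habs,
      ← tensR_assoc (n := n + 2) (m := n + 0) (n' := 1) (m' := 1), tensR_idR_idR, show 1 + t = t + 1 by omega,
      show compR (t + (n + 1)) (tensR (n + 2) (n + 0) (compR (n + 2) (tensR (n + 1) (n + 1) (jw A (n + 1)).val (idR 1))
        (tensR n n (idR n) (cupR A))) (idR (t + 1))) (jw A (t + (n + 1))).val = _ from IH', Finset.smul_sum,
      sub_eq_add_neg, add_comm, ← Finset.sum_neg_distrib]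
    unfold block
    congr 1
    refine Finset.sum_congr rfl (fun x _ => ?_)
    rw [smul_smul, ← neg_smul, Nat.add_sub_add_right]
    congr 1
    rw [pow_succ]
    field_simp

end Mor


/-! ### Re-bracketing the standard cups -/

namespace Mor

variable {A : K}

/-- An extra through-strand on the right of the standard cups (raw). [folklore] -/
theorem stdCups_right_val (x y : ℕ) : ∀ z : ℕ,
    (stdCups A x (y + 1) z).val = tensR ((x + z) + (y + z)) (x + y) (stdCups A x y z).val (idR 1)
  | 0 => by
    rw [stdCups_zero, stdCups_zero, idm_val, idm_val, show x + 0 + (y + 0) = x + y by omega, tensR_idR_idR]; rfl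
  | z + 1 => by
    rw [stdCups_succ, cast_val, comp_val, stdCups_right_val x y z, stdCups_succ, cast_val, comp_val,
      cupAt_val_congr A (show x + z + (y + 1 + z) = x + z + (y + z) + 1 by omega) rfl, ← cupAt_add_val A (by omega) 1,
      tens_val, idm_val, show x + z + (y + 1 + z) = x + z + (y + z) + 1 by omega,
      compR_tensR_tensR (cupAt A _ _).respC (stdCups A x y z).respR, compR_idR (RespC.idR 1),
      show x + (z + 1) + (y + (z + 1)) = x + z + (y + z) + 2 by omega]

/-- Extra through-strands on the left of the standard cups (raw). [folklore] -/
theorem stdCups_left_val (m x y : ℕ) : ∀ z : ℕ,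
    (stdCups A (m + x) y z).val = tensR m m (idR m) (stdCups A x y z).val
  | 0 => by
    rw [stdCups_zero, stdCups_zero, idm_val, idm_val, tensR_idR_idR, Nat.add_assoc]
  | z + 1 => by
    rw [stdCups_succ, cast_val, comp_val, stdCups_left_val m x y z, stdCups_succ, cast_val, comp_val,
      idR_tensR_compR, cupAt_val_congr A (show m + x + z + (y + z) = m + (x + z + (y + z)) by omega)
        (show m + x + z = m + (x + z) by omega), ← idm_tens_cupAt_val A m (by omega), tens_val, idm_val,
      show m + x + z + (y + z) = m + (x + z + (y + z)) by omega]

/-- **Outermost cup first**: `stdCups x y (z+1) = stdCups (x+1) (y+1) z ∘ ∪_x` (raw). [folklore] -/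
theorem stdCups_outer_val (x y : ℕ) : ∀ z : ℕ,
    (stdCups A x y (z + 1)).val = compR (x + y + 2) (stdCups A (x + 1) (y + 1) z).val (cupAt A (x + y) x).val
  | 0 => by
    rw [stdCups_succ, cast_val, comp_val, stdCups_zero, stdCups_zero, idm_val, idm_val,
      cupAt_val_congr A (show x + 0 + (y + 0) = x + y by omega) (show x + 0 = x by omega),
      show x + 0 + (y + 0) = x + y by omega,
      compR_idR (cupAt A (x + y) x).respC, show x + 1 + (y + 1) = x + y + 2 by omega, idR_compR (cupAt A (x + y) x).respR]
  | z + 1 => by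
    rw [stdCups_succ, cast_val, comp_val, stdCups_outer_val x y z, compR_assoc, stdCups_succ, cast_val, comp_val,
      cupAt_val_congr A (show x + (z + 1) + (y + (z + 1)) = x + 1 + z + (y + 1 + z) by omega)
        (show x + (z + 1) = x + 1 + z by omega),
      show x + (z + 1) + (y + (z + 1)) = x + 1 + z + (y + 1 + z) by omega]

end Mor


namespace Mor

variable {A : K}

/-- Several extra through-strands on the right of the standard cups (raw). [folklore] -/
theorem stdCups_right_val_iter (x y z : ℕ) : ∀ m : ℕ,
    (stdCups A x (y + m) z).val = tensR ((x + z) + (y + z)) (x + y) (stdCups A x y z).val (idR m)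
  | 0 => by rw [Nat.add_zero, tensR_idR_zero]
  | m + 1 => by
    rw [show y + (m + 1) = y + m + 1 by omega, stdCups_right_val, stdCups_right_val_iter x y z m,
      show x + z + (y + m + z) = x + z + (y + z) + m by omega, show x + (y + m) = x + y + m by omega, ← tensR_assoc,
      tensR_idR_idR]

/-- A cup placed under the standard cups at the outermost position gives the vertex with one more
internal line (exact form of the nesting lemma). [folklore] -/
theorem sandwich_outer_cup (x₀ y' z' : ℕ) :
    compR (x₀ + 1 + z' + (y' + 1 + z')) (tensR (x₀ + 1 + z') (x₀ + 1 + z') (jw A (x₀ + 1 + z')).val (jw A (y' + 1 + z')).val)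
      (compR (x₀ + y' + 2) (stdCups A (x₀ + 1) (y' + 1) z').val
        (compR (x₀ + y') (cupAt A (x₀ + y') x₀).val (jw A (x₀ + y')).val)) =
    (vert A x₀ (z' + 1) y').val := by
  rw [vert_def, comp_val, comp_val, tens_val, stdCups_outer_val, compR_assoc, compR_assoc,
    jw_val_congr (show x₀ + (z' + 1) = x₀ + 1 + z' by omega), jw_val_congr (show y' + (z' + 1) = y' + 1 + z' by omega),
    show x₀ + (z' + 1) + (y' + (z' + 1)) = x₀ + 1 + z' + (y' + 1 + z') by omega, show x₀ + (z' + 1) = x₀ + 1 + z' by omega]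
  simp only [compR_assoc]

end Mor


namespace Mor

variable {A : K}

/-- A cup placed under the standard cups inside the right through-strands is killed by the right
projector (raw). [folklore] -/
theorem sandwich_cup_right (hA : A ≠ 0) (x₀ y' z' p : ℕ) (hp1 : x₀ + 1 ≤ p) (hp2 : p ≤ x₀ + y')
    (hg : Good A (y' + 1 + z')) :
    compR (x₀ + 1 + z' + (y' + 1 + z')) (tensR (x₀ + 1 + z') (x₀ + 1 + z') (jw A (x₀ + 1 + z')).val (jw A (y' + 1 + z')).val)
      (compR (x₀ + y' + 2) (stdCups A (x₀ + 1) (y' + 1) z').val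
        (compR (x₀ + y') (cupAt A (x₀ + y') p).val (jw A (x₀ + y')).val)) = 0 := by
  obtain ⟨q, rfl⟩ : ∃ q, p = x₀ + 1 + q := ⟨p - x₀ - 1, by omega⟩
  obtain ⟨m', rfl⟩ : ∃ m', y' = q + m' + 1 := ⟨y' - q - 1, by omega⟩
  have hkill := congrArg Mor.val (jw_comp_cupAt hA (n := q + z' + m') (i := q + z' + 0) (by simpa [Nat.add_assoc,
    Nat.add_comm, Nat.add_left_comm] using hg) (by omega))
  rw [comp_val, zero_val, ← idm_tens_cupAt_val A (q + z') (Nat.zero_le m'), tens_val, idm_val,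
    jw_val_congr (show q + z' + m' + 2 = q + (m' + 2) + z' by omega)] at hkill
  simp only [show q + z' + m' + 2 = q + z' + (m' + 2) by omega] at hkill
  rw [show q + m' + 1 + 1 = q + (m' + 2) by omega, stdCups_right_val_iter, compR_assoc (tensR _ _ (stdCups A _ _ _).val _),
    cupAt_val_congr A (show x₀ + (q + m' + 1) = x₀ + 1 + q + m' by omega) (show x₀ + 1 + q = x₀ + 1 + q + 0 by omega),
    ← idm_tens_cupAt_val A (x₀ + 1 + q) (Nat.zero_le m'), tens_val, idm_val,
    show x₀ + (q + m' + 1) + 2 = x₀ + 1 + q + (m' + 2) by omega,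
    compR_tensR_tensR (stdCups A (x₀ + 1) q z').respC (RespR.idR _), compR_idR (stdCups A (x₀ + 1) q z').respC,
    idR_compR (cupAt A m' 0).respR]
  -- kill the cup with `f_b`
  rw [show (tensR (x₀ + 1 + z' + (q + z')) (x₀ + 1 + q) (stdCups A (x₀ + 1) q z').val (cupAt A m' 0).val) =
      compR (x₀ + 1 + z' + (q + z') + m') (tensR (x₀ + 1 + z' + (q + z')) (x₀ + 1 + z' + (q + z'))
        (idR (x₀ + 1 + z' + (q + z'))) (cupAt A m' 0).val)
        (tensR (x₀ + 1 + z' + (q + z')) (x₀ + 1 + q) (stdCups A (x₀ + 1) q z').val (idR m')) from by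
      rw [compR_tensR_tensR (RespC.idR _) (stdCups A (x₀ + 1) q z').respR, idR_compR (stdCups A (x₀ + 1) q z').respR,
        compR_idR (cupAt A m' 0).respC],
    ← tensR_idR_idR (x₀ + 1 + z') (q + z'), ← tensR_assoc,
    ← compR_assoc (tensR _ _ (idR _) _) (tensR _ _ (stdCups A _ _ _).val _) (jw A _).val,
    compR_assoc (tensR _ _ (jw A _).val (jw A _).val) (tensR _ _ (idR _) _) _,
    show x₀ + 1 + z' + (q + (m' + 2) + z') = x₀ + 1 + z' + (q + z' + (m' + 2)) by omega,
    compR_tensR_tensR (jw A (x₀ + 1 + z')).respC (RespR.idR _), hkill, tensR_zero, zero_compR]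

end Mor


namespace Mor

variable {A : K}

/-- A cup placed under the standard cups inside the left through-strands is killed by the left
projector (raw). [folklore] -/
theorem sandwich_cup_left (hA : A ≠ 0) (x₀ y' z' p : ℕ) (hp : p + 1 ≤ x₀) (hg : Good A (x₀ + 1 + z')) :
    compR (x₀ + 1 + z' + (y' + 1 + z')) (tensR (x₀ + 1 + z') (x₀ + 1 + z') (jw A (x₀ + 1 + z')).val (jw A (y' + 1 + z')).val)
      (compR (x₀ + y' + 2) (stdCups A (x₀ + 1) (y' + 1) z').val
        (compR (x₀ + y') (cupAt A (x₀ + y') p).val (jw A (x₀ + y')).val)) = 0 := by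
  obtain ⟨r, rfl⟩ : ∃ r, x₀ = p + 1 + r := ⟨x₀ - p - 1, by omega⟩
  have hkill := congrArg Mor.val (jw_comp_cupAt hA (n := p + r + z') (i := p)
    (by simpa [Nat.add_assoc, Nat.add_comm, Nat.add_left_comm] using hg) (by omega))
  rw [comp_val, zero_val, cupAt_val_congr A (show p + r + z' = p + (r + z') by omega) rfl, ← cupAt_add_val A le_rfl (r + z'),
    tens_val, idm_val, jw_val_congr (show p + r + z' + 2 = p + 2 + (r + z') by omega)] at hkill
  simp only [show p + r + z' + 2 = p + 2 + (r + z') by omega] at hkill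
  have hS3c : RespC (1 + r + y') (stdCups A r (y' + 1) z').val := by
    simpa [Nat.add_comm, Nat.add_left_comm] using (stdCups A r (y' + 1) z').respC
  rw [show p + 1 + r + 1 = p + 2 + r by omega, stdCups_left_val (p + 2) r (y' + 1) z',
    cupAt_val_congr A (show p + 1 + r + y' = p + (1 + r + y') by omega) (rfl : p = p), ← cupAt_add_val A le_rfl (1 + r + y'),
    tens_val, idm_val, compR_assoc (tensR _ _ (idR _) (stdCups A _ _ _).val),
    show p + 1 + r + y' + 2 = p + 2 + (1 + r + y') by omega, compR_tensR_tensR (RespC.idR _) (cupAt A p p).respR,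
    idR_compR (cupAt A p p).respR, compR_idR hS3c,
    show tensR (p + 2) p (cupAt A p p).val (stdCups A r (y' + 1) z').val =
      compR (p + (r + z' + (y' + 1 + z'))) (tensR (p + 2) p (cupAt A p p).val (idR (r + z' + (y' + 1 + z'))))
        (tensR p p (idR p) (stdCups A r (y' + 1) z').val) from by
      rw [compR_tensR_tensR (cupAt A p p).respC (RespR.idR p), compR_idR (cupAt A p p).respC,
        idR_compR (stdCups A r (y' + 1) z').respR],
    ← compR_assoc (tensR _ _ (cupAt A p p).val _) (tensR _ _ (idR p) _) (jw A _).val,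
    compR_assoc (tensR _ _ (jw A _).val (jw A _).val) (tensR _ _ (cupAt A p p).val _) _,
    ← tensR_idR_idR (r + z') (y' + 1 + z'), tensR_assoc,
    show p + 2 + r + z' + (y' + 1 + z') = p + 2 + (r + z') + (y' + 1 + z') by omega,
    jw_val_congr (show p + 2 + r + z' = p + 2 + (r + z') by omega), show p + 2 + r + z' = p + 2 + (r + z') by omega,
    compR_tensR_tensR (jw A (p + 2 + (r + z'))).respC ((cupAt A p p).respR.tensR (RespR.idR (r + z')) p), hkill,
    zero_tensR, zero_compR]

end Mor


namespace Mor

variable {A : K}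

/-- Bookkeeping lemma `V_eq'` of the binor tensor model of Temperley–Lieb recoupling theory (conventions of KL94 §8.2, §9). [folklore] -/
theorem V_eq' {a b c : ℕ} (x z y : ℕ) (ha : a = x + z) (hb : b = y + z) (hc : c = x + y) :
    V A a b c = (vert A x z y).cast hc.symm (by rw [ha, hb]) := by
  subst ha hb hc; rw [cast_eq_self]; exact V_eq x z y

/-- Bookkeeping lemma `Vd_eq'` of the binor tensor model of Temperley–Lieb recoupling theory (conventions of KL94 §8.2, §9). [folklore] -/
theorem Vd_eq' {a b c : ℕ} (x z y : ℕ) (ha : a = x + z) (hb : b = y + z) (hc : c = x + y) :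
    Vd A a b c = (dvert A x z y).cast (by rw [ha, hb]) hc.symm := by
  subst ha hb hc; rw [cast_eq_self]; exact Vd_eq x z y

/-- The cup-under-the-cups sandwich, all positions. [folklore] -/
theorem sandwich_cup (hA : A ≠ 0) (x₀ y' z' p : ℕ) (hp : p ≤ x₀ + y') (hgx : Good A (x₀ + 1 + z'))
    (hgy : Good A (y' + 1 + z')) :
    compR (x₀ + 1 + z' + (y' + 1 + z')) (tensR (x₀ + 1 + z') (x₀ + 1 + z') (jw A (x₀ + 1 + z')).val (jw A (y' + 1 + z')).val)
      (compR (x₀ + y' + 2) (stdCups A (x₀ + 1) (y' + 1) z').val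
        (compR (x₀ + y') (cupAt A (x₀ + y') p).val (jw A (x₀ + y')).val)) =
    if p = x₀ then (vert A x₀ (z' + 1) y').val else 0 := by
  rcases Nat.lt_trichotomy p x₀ with h | h | h
  · rw [if_neg h.ne]; exact sandwich_cup_left hA x₀ y' z' p h hgx
  · subst h; rw [if_pos rfl]; exact sandwich_outer_cup p y' z'
  · rw [if_neg (Nat.ne_of_gt h)]; exact sandwich_cup_right hA x₀ y' z' p h hp hgy

/-- **The elementary recoupling with the cup vertex** (`E₊₊`): for `x = x₀+1+z'`, `y = y'+z'`,
`z = x₀+y'`, `(𝟙_x ⊗ f_{y+1}) L^{x,y,1}_{z; z+1} = (-1)^{y'} (Δ_{x₀}/Δ_z) V(x, y+1; z)`. [folklore] -/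
theorem treeL_pp (hA : A ≠ 0) (x₀ z' y' : ℕ) (hgx : Good A (x₀ + 1 + z' + 1)) (hgy : Good A (y' + z' + 2))
    (hgz : Good A (x₀ + y' + 2)) :
    (idm (x₀ + 1 + z') ⊗ₘ jw A (y' + z' + 1) :) ⊚ treeL A (x₀ + 1 + z') (y' + z') 1 (x₀ + y') (x₀ + y' + 1) =
      ((-1 : K) ^ y' * (Delta A x₀ / Delta A (x₀ + y'))) • V A (x₀ + 1 + z') (y' + z' + 1) (x₀ + y') := by
  have hb := congrArg Mor.val (bend_jw hA (x₀ + y') 0 (hgz.mono (by omega)))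
  simp only [comp_val, cast_val, tens_val, idm_val, cup_val, sum_val, smul_val, Nat.add_zero, tensR_idR_zero] at hb
  rw [jw_val_congr (show 0 + (x₀ + y') = x₀ + y' by omega)] at hb
  simp only [show 0 + (x₀ + y') = x₀ + y' by omega, cupAt_val_congr A (show 0 + (x₀ + y') = x₀ + y' by omega) rfl] at hb
  rw [treeL, V_eq' (x₀ + 1) z' y' rfl rfl (by omega), V_eq' (x₀ + y') 1 0 rfl (by omega) (by omega),
    V_eq' x₀ (z' + 1) y' (by omega) (by omega) rfl, vert_def A (x₀ + 1) z' y', vert_def A (x₀ + y') 1 0,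
    stdCups_succ A (x₀ + y') 0 0, stdCups_zero]
  have hcl := congrArg Mor.val (cupAt_last (A := A) (x₀ + y'))
  rw [cast_val, tens_val, idm_val, cup_val] at hcl
  have hidem := congrArg Mor.val (jw_idem' hA (n := x₀ + y' + 1) (hgz.mono (by omega)))
  rw [comp_val] at hidem
  have habsR := congrArg Mor.val (jw_absorb_right hA (n := y' + z') (hgy.mono (by omega)))
  rw [comp_val, tens_val, idm_val] at habsR
  have hsr := stdCups_right_val (A := A) (x₀ + 1) y' z'
  simp only [show x₀ + 1 + y' = x₀ + y' + 1 by omega] at hsr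
  have hS1c : RespC (x₀ + y' + 1) (stdCups A (x₀ + 1) y' z').val := by
    simpa only [show x₀ + 1 + y' = x₀ + y' + 1 by omega] using (stdCups A (x₀ + 1) y' z').respC
  apply ext'
  simp only [comp_val, cast_val, tens_val, idm_val, smul_val, Nat.add_zero]
  rw [jw_val_congr (show x₀ + 1 + y' = x₀ + y' + 1 by omega), compR_idR (cupAt A (x₀ + y') (x₀ + y')).respC, hcl]
  simp only [show x₀ + 1 + y' = x₀ + y' + 1 by omega, show x₀ + y' + 1 + (0 + 1) = x₀ + y' + 1 + 1 from rfl]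
  -- split `V ⊗ 𝟙` and merge the two copies of `f_{z+1} ⊗ 𝟙`
  rw [jw_val_congr (show 0 + 1 = 1 from rfl), jw_one, idm_val, tensR_compR_idR 1 (hS1c.compR _ _) (jw A (x₀ + y' + 1)).respR,
    tensR_compR_idR 1 (((jw A (x₀ + 1 + z')).respC.tensR (jw A (y' + z')).respC _)) (stdCups A (x₀ + 1) y' z').respR,
    ← hsr, ← compR_assoc _ (tensR _ _ (jw A (x₀ + y' + 1)).val (idR 1)) _,
    compR_assoc (tensR _ _ (jw A (x₀ + y' + 1)).val (idR 1)) (compR _ (tensR _ _ (jw A (x₀ + y' + 1)).val (idR 1)) _) _,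
    compR_assoc (tensR _ _ (jw A (x₀ + y' + 1)).val (idR 1)) (tensR _ _ (jw A (x₀ + y' + 1)).val (idR 1)) _,
    compR_tensR_tensR (jw A (x₀ + y' + 1)).respC (jw A (x₀ + y' + 1)).respR, hidem, compR_idR (RespC.idR 1), hb]
  -- distribute, then evaluate each cup
  simp only [compR_sum, compR_smul]
  rw [Finset.sum_eq_single y' (fun s hs hsy => ?_) (fun h => absurd (Finset.mem_range.mpr (by omega)) h)]
  · rw [← compR_assoc (tensR _ _ (tensR _ _ (jw A _).val (jw A _).val) (idR 1)) (stdCups A _ _ _).val _,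
      compR_assoc (tensR _ _ (idR _) (jw A _).val) (tensR _ _ (tensR _ _ (jw A _).val (jw A _).val) (idR 1)) _,
      ← tensR_assoc (X := (jw A (x₀ + 1 + z')).val) (n := x₀ + 1 + z') (m := x₀ + 1 + z') (n' := y' + z') (m' := y' + z'),
      show x₀ + 1 + z' + (y' + z' + 1) = x₀ + 1 + z' + (y' + z' + 1) from rfl,
      compR_tensR_tensR (RespC.idR (x₀ + 1 + z')) (jw A (x₀ + 1 + z')).respR, idR_compR (jw A (x₀ + 1 + z')).respR, habsR,
      jw_val_congr (show y' + z' + 1 = y' + 1 + z' by omega), show x₀ + y' - y' = x₀ by omega]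
    simp only [show x₀ + 1 + z' + (y' + z') + 1 = x₀ + 1 + z' + (y' + 1 + z') by omega,
      show x₀ + y' + 1 + 1 = x₀ + y' + 2 by omega]
    rw [sandwich_cup hA x₀ y' z' x₀ (by omega) (hgx.mono (by omega)) (hgy.mono (by omega)), if_pos rfl]
  · rw [← compR_assoc (tensR _ _ (tensR _ _ (jw A _).val (jw A _).val) (idR 1)) (stdCups A _ _ _).val _,
      compR_assoc (tensR _ _ (idR _) (jw A _).val) (tensR _ _ (tensR _ _ (jw A _).val (jw A _).val) (idR 1)) _,
      ← tensR_assoc (X := (jw A (x₀ + 1 + z')).val) (n := x₀ + 1 + z') (m := x₀ + 1 + z') (n' := y' + z') (m' := y' + z'),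
      compR_tensR_tensR (RespC.idR (x₀ + 1 + z')) (jw A (x₀ + 1 + z')).respR, idR_compR (jw A (x₀ + 1 + z')).respR, habsR,
      jw_val_congr (show y' + z' + 1 = y' + 1 + z' by omega)]
    simp only [show x₀ + 1 + z' + (y' + z') + 1 = x₀ + 1 + z' + (y' + 1 + z') by omega,
      show x₀ + y' + 1 + 1 = x₀ + y' + 2 by omega]
    have hs' := Finset.mem_range.mp hs
    rw [sandwich_cup hA x₀ y' z' (x₀ + y' - s) (Nat.sub_le _ _) (hgx.mono (by omega)) (hgy.mono (by omega)),
      if_neg (by omega), smul_zero]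

end Mor


namespace Mor

variable {A : K}

/-- Bookkeeping lemma `thetaL_eq'` of the binor tensor model of Temperley–Lieb recoupling theory (conventions of KL94 §8.2, §9). [folklore] -/
theorem thetaL_eq' {a b c : ℕ} (x z y : ℕ) (ha : a = x + z) (hb : b = y + z) (hc : c = x + y) :
    thetaL A a b c = theta A x z y := by
  subst ha hb hc; exact thetaL_eq x z y

/-- `V^∨(y, 1; y+1) = f_{y+1}` (raw). [folklore] -/
theorem Vd_one_up_val (hA : A ≠ 0) (y : ℕ) (hg : Good A (y + 1)) : (Vd A y 1 (y + 1)).val = (jw A (y + 1)).val := by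
  have h := congrArg Mor.val (jw_absorb_right hA (n := y) hg)
  rw [comp_val, tens_val, idm_val] at h
  rw [Vd_eq' y 0 1 (by omega) (by omega) (by omega), cast_val, dvert_def, stdCaps_zero, comp_val, comp_val, idm_val,
    tens_val, jw_val_congr (Nat.add_zero y), jw_val_congr (show 1 + 0 = 1 from rfl), jw_one, idm_val,
    compR_idR (jw A (y + 1)).respC]
  exact h

/-- **`E₊₊`**: `F^{x,y,1}_{z; z+1, y+1} = (-1)^{y'} Δ_{x₀}/Δ_z = [x₀+1]/[z+1]` where `x = x₀+1+z'`,
`y = y'+z'`, `z = x₀+y'`. [cite: KauffmanLins1994, §9.12 (special values)] -/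
theorem Fco_pp (hA : A ≠ 0) (x₀ z' y' : ℕ) (hgx : Good A (x₀ + 1 + z' + 1)) (hgy : Good A (y' + z' + 2))
    (hgz : Good A (x₀ + y' + 2)) (hθ : thetaL A (x₀ + 1 + z') (y' + z' + 1) (x₀ + y') ≠ 0) :
    Fco A (x₀ + 1 + z') (y' + z') 1 (x₀ + y') (x₀ + y' + 1) (y' + z' + 1) = lam A x₀ y' := by
  have hT : treeRd A (x₀ + 1 + z') (y' + z') 1 (x₀ + y') (y' + z' + 1) ⊚ treeL A (x₀ + 1 + z') (y' + z') 1 (x₀ + y') (x₀ + y' + 1)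
      = Vd A (x₀ + 1 + z') (y' + z' + 1) (x₀ + y') ⊚ ((idm (x₀ + 1 + z') ⊗ₘ jw A (y' + z' + 1) :) ⊚
        treeL A (x₀ + 1 + z') (y' + z') 1 (x₀ + y') (x₀ + y' + 1)) := by
    apply ext'
    simp only [treeRd, comp_val, cast_val, tens_val, idm_val, Vd_one_up_val hA (y' + z') (hgy.mono (by omega)),
      compR_assoc]
    rfl
  have hθ1 : thetaL A (y' + z') 1 (y' + z' + 1) = Delta A (y' + z' + 1) := by
    rw [thetaL_eq' (y' + z') 0 1 (by omega) (by omega) (by omega), theta_zero_mid hA _ _ (hgy.mono (by omega)),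
      show y' + z' + 1 = y' + z' + 1 from rfl]
  rw [Fco, Tnet, hT, treeL_pp hA x₀ z' y' hgx hgy hgz, comp_smul, trAll_smul, ← thetaL, hθ1, lam]
  have hΔ : Delta A (y' + z' + 1) ≠ 0 := hgy _ (by omega)
  field_simp

end Mor


namespace Mor

variable {A : K}

/-- **The elementary recoupling with the trivial vertex** (`E₋₊`): for `x = x'+z'`, `y = y'+z'`,
`z = x'+y'+1`: `(𝟙_x ⊗ f_{y+1}) L^{x,y,1}_{z; z-1} = V(x, y+1; z)` exactly. [folklore] -/
theorem treeL_mp (hA : A ≠ 0) (x' z' y' : ℕ) (hgy : Good A (y' + z' + 2)) (hgz : Good A (x' + y' + 2)) :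
    (idm (x' + z') ⊗ₘ jw A (y' + z' + 1) :) ⊚ treeL A (x' + z') (y' + z') 1 (x' + y' + 1) (x' + y') =
      V A (x' + z') (y' + z' + 1) (x' + y' + 1) := by
  have habsR := congrArg Mor.val (jw_absorb_right hA (n := y' + z') (hgy.mono (by omega)))
  rw [comp_val, tens_val, idm_val] at habsR
  have habsL := congrArg Mor.val (jw_absorb_left hA (n := x' + y') (hgz.mono (by omega)))
  rw [comp_val, tens_val, idm_val] at habsL
  have hsr := stdCups_right_val (A := A) x' y' z'
  rw [treeL, V_eq' x' z' y' rfl rfl rfl, V_eq' (x' + y') 0 1 (by omega) (by omega) rfl,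
    V_eq' x' z' (y' + 1) rfl (by omega) (by omega), vert_def A x' z' y', vert_def A (x' + y') 0 1, stdCups_zero]
  apply ext'
  simp only [comp_val, cast_val, tens_val, idm_val, Nat.add_zero, vert_def]
  rw [jw_val_congr (show 1 + 0 = 1 from rfl), jw_one, idm_val, compR_idR ((jw A (x' + y')).respC.tensR (RespC.idR 1) _),
    habsL, tensR_compR_idR 1 ((stdCups A x' y' z').respC.compR _ _) (jw A (x' + y')).respR,
    tensR_compR_idR 1 (((jw A (x' + z')).respC.tensR (jw A (y' + z')).respC _)) (stdCups A x' y' z').respR, ← hsr,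
    ← compR_assoc _ (tensR _ _ (jw A (x' + y')).val (idR 1)) _, habsL,
    ← compR_assoc (tensR _ _ (tensR _ _ (jw A _).val (jw A _).val) (idR 1)) (stdCups A _ _ _).val _,
    compR_assoc (tensR _ _ (idR _) (jw A _).val) (tensR _ _ (tensR _ _ (jw A _).val (jw A _).val) (idR 1)) _,
    ← tensR_assoc (X := (jw A (x' + z')).val) (n := x' + z') (m := x' + z') (n' := y' + z') (m' := y' + z'),
    compR_tensR_tensR (RespC.idR (x' + z')) (jw A (x' + z')).respR, idR_compR (jw A (x' + z')).respR, habsR,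
    jw_val_congr (show y' + 1 + z' = y' + z' + 1 by omega), compR_assoc, jw_val_congr (show x' + (y' + 1) = x' + y' + 1 by omega)]
  simp only [show x' + z' + (y' + 1 + z') = x' + z' + (y' + z') + 1 by omega, show x' + (y' + 1) = x' + y' + 1 by omega]

/-- **`E₋₊ = 1`**: `F^{x,y,1}_{z; z-1, y+1} = 1` (`x = x'+z'`, `y = y'+z'`, `z = x'+y'+1`).
[cite: KauffmanLins1994, §9.12 (special values)] -/
theorem Fco_mp (hA : A ≠ 0) (x' z' y' : ℕ) (hgy : Good A (y' + z' + 2)) (hgz : Good A (x' + y' + 2))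
    (hθ : thetaL A (x' + z') (y' + z' + 1) (x' + y' + 1) ≠ 0) :
    Fco A (x' + z') (y' + z') 1 (x' + y' + 1) (x' + y') (y' + z' + 1) = 1 := by
  have hT : treeRd A (x' + z') (y' + z') 1 (x' + y' + 1) (y' + z' + 1) ⊚ treeL A (x' + z') (y' + z') 1 (x' + y' + 1) (x' + y')
      = Vd A (x' + z') (y' + z' + 1) (x' + y' + 1) ⊚ ((idm (x' + z') ⊗ₘ jw A (y' + z' + 1) :) ⊚
        treeL A (x' + z') (y' + z') 1 (x' + y' + 1) (x' + y')) := by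
    apply ext'
    simp only [treeRd, comp_val, cast_val, tens_val, idm_val, Vd_one_up_val hA (y' + z') (hgy.mono (by omega)),
      compR_assoc]
    rfl
  have hθ1 : thetaL A (y' + z') 1 (y' + z' + 1) = Delta A (y' + z' + 1) := by
    rw [thetaL_eq' (y' + z') 0 1 (by omega) (by omega) (by omega), theta_zero_mid hA _ _ (hgy.mono (by omega))]
  rw [Fco, Tnet, hT, treeL_mp hA x' z' y' hgy hgz, ← thetaL, hθ1]
  have hΔ : Delta A (y' + z' + 1) ≠ 0 := hgy _ (by omega)
  field_simp

end Mor


/-! ### Helpers for the transposed elementary networks -/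

namespace Mor

variable {A : K}

/-- Bookkeeping lemma `trpm_Vd` of the binor tensor model of Temperley–Lieb recoupling theory (conventions of KL94 §8.2, §9). [folklore] -/
theorem trpm_Vd (a b c : ℕ) : trpm (Vd A a b c) = ((-1 : K) ^ ((a + b - c) / 2)) • V A a b c := by
  by_cases h : Tri a b c
  · obtain ⟨x, z, y, rfl, rfl, rfl⟩ := h.decompose
    rw [V_eq, Vd_eq, trpm_dvert, show (x + z + (y + z) - (x + y)) / 2 = z by omega]
  · rw [V_of_not_tri h, Vd_of_not_tri h, trpm_zero, smul_zero]

/-- Sliding a cup around the corner of a partial trace: `rptr ((𝟙_n ⊗ ∪) W) = (W ⊗ 𝟙)(𝟙_m ⊗ ∪)`. [folklore] -/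
theorem rptr_idm_cup_comp (hA : A ≠ 0) (n : ℕ) (W : Mor K (m + 1) n) :
    rptr A ((idm n ⊗ₘ cup A :) ⊚ W) = (W ⊗ₘ idm 1 :) ⊚ (idm m ⊗ₘ cup A :) := by
  have h := congrArg Mor.val (capAt_succ_cupAt A hA (n := n + 1) (i := n) le_rfl)
  rw [comp_val, idm_val, capAt_val A le_rfl, cupAt_val A (Nat.le_succ n), Nat.sub_self,
    show n + 1 - n = 1 by omega] at h
  unfold block at h
  rw [tensR_idR_zero] at h
  have hCc : RespC n (tensR n n (idR n) (cupR A)) := by simpa using (RespC.idR (K := K) n).tensR (RespC.cupR A 0) n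
  have h' : compR (n + 3) (tensR (n + 1) (n + 1) (idR (n + 1)) (capR A))
      (tensR (n + 1 + 1) n (tensR n n (idR n) (cupR A)) (idR 1)) = idR (n + 1) := h
  apply ext'
  rw [rptr_val, comp_val, comp_val, tens_val, tens_val, tens_val, idm_val, idm_val, idm_val, cup_val]
  show compR (m + 1 + 1) (compR (n + 3) (tensR (n + 1) (n + 1) (idR (n + 1)) (capR A))
    (tensR (n + 1 + 1) (m + 1) (compR n (tensR n n (idR n) (cupR A)) W.val) (idR 1))) (tensR m m (idR m) (cupR A)) =
    compR (m + 1 + 1) (tensR n (m + 1) W.val (idR 1)) (tensR m m (idR m) (cupR A))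
  rw [tensR_compR_idR 1 hCc W.respR, compR_assoc, h', idR_compR (W.respR.tensR (RespR.idR 1) _)]

/-- A cup inside the box of `f_y ⊗ 𝟙` is killed. [folklore] -/
theorem jw_tens_idm_comp_cupAt (hA : A ≠ 0) (y₀ q : ℕ) (hq : q ≤ y₀) (hg : Good A (y₀ + 2)) :
    (jw A (y₀ + 2) ⊗ₘ idm 1 :) ⊚ cupAt A (y₀ + 1) q = 0 := by
  rw [cupAt_succ A hq, tens_idm_comp_tens_idm, jw_comp_cupAt hA hg hq, zero_tens]

end Mor


namespace Mor

variable {A : K}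

/-- `θ(n+1, 1, n) = Δ_{n+1}`: `theta n 1 0 = Δ_{n+1}`. [folklore] -/
theorem theta_one_zero (hA : A ≠ 0) : ∀ n : ℕ, Good A (n + 2) → theta A n 1 0 = Delta A (n + 1)
  | 0 => fun hg => by simpa using theta_zero_one hA 0 (by simpa using hg)
  | n + 1 => fun hg => by
    rw [theta_succ_succ hA n 0 0 (hg.mono (by omega)) (hg.mono (by omega)) (hg.mono (by omega)),
      theta_zero_mid hA (n + 1) 0 (hg.mono (by omega)), lam_zero (hg n (by omega)),
      theta_zero_mid hA n 1 (hg.mono (by omega)), Delta_succ_succ, Delta_one, Delta_zero]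
    simp only [Nat.add_zero, div_one, one_pow, one_mul]
    rw [div_mul_cancel₀ _ (hg (n + 1) (by omega))]

/-- The `E₋₋` network, transposed: `Tet = tr( V^∨(z-1,1;z) (V^∨(x,y;z-1) ⊗ 𝟙) (𝟙 ⊗ V(y,1;y-1)) V(x,y-1;z) )`. [folklore] -/
theorem Tnet_mm_transpose (x' z₀ y' : ℕ) :
    Tnet A (x' + z₀ + 1) (y' + z₀ + 1) 1 (x' + y' + 1) (x' + y') (y' + z₀) =
      trAll A (Vd A (x' + y') 1 (x' + y' + 1) ⊚ (Vd A (x' + z₀ + 1) (y' + z₀ + 1) (x' + y') ⊗ₘ idm 1 :) ⊚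
        ((idm (x' + z₀ + 1) ⊗ₘ V A (y' + z₀ + 1) 1 (y' + z₀) :).cast rfl (by omega)) ⊚
        V A (x' + z₀ + 1) (y' + z₀) (x' + y' + 1)) := by
  rw [Tnet, ← trAll_trpm, trpm_comp, treeL, treeRd, trpm_comp, trpm_comp, trpm_cast, trpm_tens, trpm_tens, trpm_idm,
    trpm_idm, trpm_V, trpm_V, trpm_Vd, trpm_Vd,
    show (x' + y' + 1 - (x' + y' + 1)) / 2 = 0 by omega,
    show (x' + z₀ + 1 + (y' + z₀ + 1) - (x' + y')) / 2 = z₀ + 1 by omega,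
    show (y' + z₀ + 1 + 1 - (y' + z₀)) / 2 = 1 by omega,
    show (x' + z₀ + 1 + (y' + z₀) - (x' + y' + 1)) / 2 = z₀ by omega,
    pow_zero, one_smul, pow_one, smul_tens, tens_smul, cast_smul]
  simp only [smul_comp, comp_smul, smul_smul, trAll_smul, comp_assoc]
  rw [pow_succ, show (-1 : K) ^ z₀ * -1 * ((-1) ^ z₀ * -1) = (-1) ^ z₀ * (-1) ^ z₀ by ring, ← mul_pow, neg_one_mul,
    neg_neg, one_pow, one_mul]

end Mor


namespace Mor

variable {A : K}

/-- Bookkeeping lemma `tensR_sum` of the binor tensor model of Temperley–Lieb recoupling theory (conventions of KL94 §8.2, §9). [folklore] -/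
theorem tensR_sum {ι : Type*} (S : Finset ι) (X : Raw K) (Y : ι → Raw K) :
    tensR n m X (∑ i ∈ S, Y i) = ∑ i ∈ S, tensR n m X (Y i) := by
  classical
  induction S using Finset.induction_on with
  | empty => simp [tensR_zero]
  | insert a S ha IH => rw [Finset.sum_insert ha, Finset.sum_insert ha, tensR_add, IH]

/-- Expanding the cup vertex `V(y,1;y-1)` sitting in the right block of `V(x,y-1;z)` (bent strand). [folklore] -/
theorem idm_tens_Vcup_comp_V (hA : A ≠ 0) (x' z₀ y' : ℕ) (hgy : Good A (y' + z₀ + 2)) :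
    ((idm (x' + z₀ + 1) ⊗ₘ V A (y' + z₀ + 1) 1 (y' + z₀) :).cast rfl
        (show x' + z₀ + 1 + (y' + z₀ + 1 + 1) = x' + z₀ + 1 + (y' + z₀ + 1) + 1 by omega)) ⊚
      V A (x' + z₀ + 1) (y' + z₀) (x' + y' + 1) =
    ∑ s ∈ Finset.range (y' + z₀ + 1), ((-1 : K) ^ s * (Delta A (y' + z₀ - s) / Delta A (y' + z₀))) •
      (((idm (x' + z₀ + 1) ⊗ₘ cupAt A (y' + z₀) (y' + z₀ - s) :).cast rfl
        (show x' + z₀ + 1 + (y' + z₀ + 2) = x' + z₀ + 1 + (y' + z₀ + 1) + 1 by omega)) ⊚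
        V A (x' + z₀ + 1) (y' + z₀) (x' + y' + 1)) := by
  have hb := congrArg Mor.val (bend_jw hA (y' + z₀) 0 (hgy.mono (by omega)))
  simp only [comp_val, cast_val, tens_val, idm_val, cup_val, sum_val, smul_val, Nat.add_zero, tensR_idR_zero] at hb
  rw [jw_val_congr (show 0 + (y' + z₀) = y' + z₀ by omega)] at hb
  simp only [show 0 + (y' + z₀) = y' + z₀ by omega, cupAt_val_congr A (show 0 + (y' + z₀) = y' + z₀ by omega) rfl] at hb
  have hcl := congrArg Mor.val (cupAt_last (A := A) (y' + z₀))
  rw [cast_val, tens_val, idm_val, cup_val] at hcl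
  have hidem := congrArg Mor.val (jw_idem' hA (n := y' + z₀) (hgy.mono (by omega)))
  rw [comp_val] at hidem
  rw [V_eq' (y' + z₀) 1 0 rfl (by omega) (by omega), V_eq' (x' + 1) z₀ y' (by omega) (by omega) (by omega),
    vert_def A (y' + z₀) 1 0, stdCups_succ, stdCups_zero]
  apply ext'
  simp only [comp_val, cast_val, tens_val, idm_val, sum_val, smul_val, Nat.add_zero, vert_def]
  rw [jw_val_congr (show 0 + 1 = 1 from rfl), jw_one, idm_val, compR_idR (cupAt A _ _).respC, hcl]
  simp only [show (0 : ℕ) + 1 = 1 from rfl]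
  rw [hb, tensR_sum, sum_compR]
  simp only [jw_val_congr (show x' + 1 + z₀ = x' + z₀ + 1 by omega), show x' + 1 + z₀ = x' + z₀ + 1 by omega]
  refine Finset.sum_congr rfl (fun s _ => ?_)
  rw [tensR_smul, smul_compR, idR_tensR_compR,
    ← compR_assoc (tensR _ _ (idR _) (cupAt A _ _).val) (tensR _ _ (idR _) (jw A _).val) _,
    ← compR_assoc (tensR _ _ (jw A _).val (jw A _).val) (stdCups A _ _ _).val (jw A _).val,
    compR_assoc (tensR _ _ (idR _) (jw A _).val) (tensR _ _ (jw A _).val (jw A _).val) _,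
    compR_tensR_tensR (RespC.idR _) (jw A _).respR, idR_compR (jw A _).respR, hidem,
    compR_assoc (tensR _ _ (jw A _).val (jw A _).val) (stdCups A _ _ _).val (jw A _).val]

end Mor


namespace Mor

variable {A : K}

/-- A cup strictly inside the right block is killed by `V^∨ ⊗ 𝟙`. [folklore] -/
theorem Vd_tens_idm_comp_cup (hA : A ≠ 0) (x y₀ c q : ℕ) (hq : q ≤ y₀) (hgx : Good A x) (hgy : Good A (y₀ + 2))
    (h : x + (y₀ + 1 + 2) = x + (y₀ + 2) + 1) :
    (Vd A x (y₀ + 2) c ⊗ₘ idm 1 :) ⊚ ((idm x ⊗ₘ cupAt A (y₀ + 1) q :).cast rfl h) = 0 := by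
  have hk := congrArg Mor.val (jw_tens_idm_comp_cupAt hA y₀ q hq hgy)
  rw [comp_val, tens_val, idm_val, zero_val] at hk
  rw [← Vd_comp_jw_tens_jw hA _ _ c hgx hgy]
  apply ext'
  rw [comp_val, tens_val, comp_val, tens_val, idm_val, cast_val, tens_val, idm_val, zero_val,
    tensR_compR_idR 1 (Vd A _ _ _).respC ((jw A x).respR.tensR (jw A (y₀ + 2)).respR x), ← compR_assoc,
    ← tensR_assoc, show x + (y₀ + 2) + 1 = x + (y₀ + 2 + 1) by omega,
    compR_tensR_tensR (jw A x).respC (RespR.idR x), hk, tensR_zero, compR_zero]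

/-- Bookkeeping lemma `rptr_cast_tgt` of the binor tensor model of Temperley–Lieb recoupling theory (conventions of KL94 §8.2, §9). [folklore] -/
theorem rptr_cast_tgt {n n' : ℕ} (Y : Mor K (m + 1) (n + 1)) (h : n + 1 = n' + 1) :
    rptr A (Y.cast rfl h) = (rptr A Y).cast rfl (by omega) := by
  obtain rfl : n = n' := by omega
  rfl

end Mor


namespace Mor

variable {A : K}

/-- Bookkeeping lemma `Vd_tens_idm_comp_cup'` of the binor tensor model of Temperley–Lieb recoupling theory (conventions of KL94 §8.2, §9). [folklore] -/
theorem Vd_tens_idm_comp_cup' (hA : A ≠ 0) (x n c q : ℕ) (hq : q + 1 ≤ n) (hgx : Good A x) (hgy : Good A (n + 1))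
    (h : x + (n + 2) = x + (n + 1) + 1) :
    (Vd A x (n + 1) c ⊗ₘ idm 1 :) ⊚ ((idm x ⊗ₘ cupAt A n q :).cast rfl h) = 0 := by
  obtain ⟨y₀, rfl⟩ : ∃ y₀, n = y₀ + 1 := ⟨n - 1, by omega⟩
  exact Vd_tens_idm_comp_cup hA x y₀ c q (by omega) hgx hgy h

/-- The surviving term of the `E₋₋` network. [folklore] -/
theorem Tnet_mm_s0 (hA : A ≠ 0) (x' z₀ y' : ℕ) (hgx : Good A (x' + z₀ + 2)) (hgy : Good A (y' + z₀ + 2))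
    (hgz : Good A (x' + y' + 2)) :
    trAll A ((Vd A (x' + z₀ + 1) (y' + z₀ + 1) (x' + y') ⊗ₘ idm 1 :) ⊚
      ((((idm (x' + z₀ + 1) ⊗ₘ cupAt A (y' + z₀) (y' + z₀) :).cast rfl
        (show x' + z₀ + 1 + (y' + z₀ + 2) = x' + z₀ + 1 + (y' + z₀ + 1) + 1 by omega)) ⊚
        V A (x' + z₀ + 1) (y' + z₀) (x' + y' + 1)))) =
    lam A x' y' * thetaL A (x' + z₀ + 1) (y' + z₀ + 1) (x' + y') := by
  have hcl := congrArg Mor.val (cupAt_last (A := A) (y' + z₀))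
  rw [cast_val, tens_val, idm_val, cup_val] at hcl
  have e1 : (((idm (x' + z₀ + 1) ⊗ₘ cupAt A (y' + z₀) (y' + z₀) :).cast rfl
        (show x' + z₀ + 1 + (y' + z₀ + 2) = x' + z₀ + 1 + (y' + z₀ + 1) + 1 by omega)) ⊚
        V A (x' + z₀ + 1) (y' + z₀) (x' + y' + 1)) =
      ((idm (x' + z₀ + 1 + (y' + z₀)) ⊗ₘ cup A :) ⊚ V A (x' + z₀ + 1) (y' + z₀) (x' + y' + 1)).cast rfl
        (show x' + z₀ + 1 + (y' + z₀) + 2 = x' + z₀ + 1 + (y' + z₀ + 1) + 1 by omega) := by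
    apply ext'
    rw [comp_val, cast_val, tens_val, idm_val, hcl, tensR_assoc, tensR_idR_idR, cast_val, comp_val, tens_val, idm_val,
      cup_val]
    rfl
  rw [e1, trAll_succ, rptr_tens_idm_comp, rptr_cast_tgt, rptr_idm_cup_comp hA,
    ← jw_comp_Vd hA (x' + z₀ + 1) (y' + z₀ + 1) (x' + y') (hgz.mono (by omega)), ← comp_assoc,
    trAll_comp_comm hA (IsTL.jw (x' + y'))]
  -- auxiliary raw facts
  have hb := congrArg Mor.val (bend_jw hA (x' + y') 0 (hgz.mono (by omega)))
  simp only [comp_val, cast_val, tens_val, idm_val, cup_val, sum_val, smul_val, Nat.add_zero, tensR_idR_zero] at hb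
  rw [jw_val_congr (show 0 + (x' + y') = x' + y' by omega)] at hb
  simp only [show 0 + (x' + y') = x' + y' by omega, cupAt_val_congr A (show 0 + (x' + y') = x' + y' by omega) rfl] at hb
  have habsV := congrArg Mor.val (Vd_comp_jw_tens_jw hA (x' + z₀ + 1) (y' + z₀ + 1) (x' + y') (hgx.mono (by omega))
    (hgy.mono (by omega)))
  rw [comp_val, tens_val] at habsV
  have hidem := congrArg Mor.val (jw_idem' hA (n := x' + z₀ + 1) (hgx.mono (by omega)))
  rw [comp_val] at hidem
  have habsR := congrArg Mor.val (jw_absorb_right hA (n := y' + z₀) (hgy.mono (by omega)))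
  rw [comp_val, tens_val, idm_val] at habsR
  have hsr := stdCups_right_val (A := A) (x' + 1) y' z₀
  simp only [show x' + 1 + y' = x' + y' + 1 by omega, show x' + 1 + z₀ = x' + z₀ + 1 by omega] at hsr
  have hS1c : RespC (x' + y' + 1) (stdCups A (x' + 1) y' z₀).val := by
    simpa only [show x' + 1 + y' = x' + y' + 1 by omega] using (stdCups A (x' + 1) y' z₀).respC
  have hsw : ∀ p, p ≤ x' + y' → compR (x' + z₀ + 1 + (y' + z₀ + 1)) (tensR (x' + z₀ + 1) (x' + z₀ + 1)
      (jw A (x' + z₀ + 1)).val (jw A (y' + z₀ + 1)).val) (compR (x' + y' + 2) (stdCups A (x' + 1) (y' + 1) z₀).val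
        (compR (x' + y') (cupAt A (x' + y') p).val (jw A (x' + y')).val)) =
      if p = x' then (vert A x' (z₀ + 1) y').val else 0 := by
    intro p hp
    have h := sandwich_cup hA x' y' z₀ p hp (hgx.mono (by omega)) (hgy.mono (by omega))
    rw [jw_val_congr (show x' + 1 + z₀ = x' + z₀ + 1 by omega), jw_val_congr (show y' + 1 + z₀ = y' + z₀ + 1 by omega)] at h
    simpa only [show x' + 1 + z₀ = x' + z₀ + 1 by omega, show y' + 1 + z₀ = y' + z₀ + 1 by omega] using h
  -- to raw matrices
  rw [thetaL, V_eq' (x' + 1) z₀ y' (by omega) rfl (by omega), V_eq' x' (z₀ + 1) y' (by omega) (by omega) rfl,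
    trAll_eq_trW, trAll_eq_trW]
  simp only [comp_val, cast_val, tens_val, idm_val, cup_val]
  rw [vert_def A (x' + 1) z₀ y']
  simp only [comp_val, tens_val, jw_val_congr (show x' + 1 + z₀ = x' + z₀ + 1 by omega),
    jw_val_congr (show x' + 1 + y' = x' + y' + 1 by omega), show x' + 1 + z₀ = x' + z₀ + 1 by omega,
    show x' + 1 + y' = x' + y' + 1 by omega]
  have hS1r : RespR (x' + z₀ + 1 + (y' + z₀)) (stdCups A (x' + 1) y' z₀).val := by
    simpa only [show x' + 1 + z₀ = x' + z₀ + 1 by omega] using (stdCups A (x' + 1) y' z₀).respR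
  have hTsum : ∀ (S : Finset ℕ) (f : ℕ → Raw K), trW A (x' + y') (∑ i ∈ S, f i) = ∑ i ∈ S, trW A (x' + y') (f i) := by
    intro S f
    induction S using Finset.cons_induction with
    | empty => simp
    | cons a S ha ih => rw [Finset.sum_cons, Finset.sum_cons, trW_add, ih]
  -- split `V ⊗ 𝟙`, isolate the bent strand and expand it
  rw [tensR_compR_idR 1 (hS1c.compR _ _) (jw A (x' + y' + 1)).respR,
    tensR_compR_idR 1 (((jw A (x' + z₀ + 1)).respC.tensR (jw A (y' + z₀)).respC _)) hS1r, ← hsr,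
    ← compR_assoc _ (tensR _ _ (jw A (x' + y' + 1)).val (idR 1)) (tensR _ _ (idR _) (cupR A)),
    compR_assoc (Vd A _ _ _).val _ (compR _ (tensR _ _ (jw A (x' + y' + 1)).val (idR 1)) _),
    ← compR_assoc (compR _ (Vd A _ _ _).val _) _ (jw A (x' + y')).val, hb, compR_sum, hTsum,
    Finset.sum_eq_single y' (fun t ht hty => ?_) (fun h => absurd (Finset.mem_range.mpr (by omega)) h)]
  · rw [compR_smul, trW_smul, ← compR_assoc (Vd A _ _ _).val _ _,
      ← compR_assoc (tensR _ _ (tensR _ _ (jw A _).val (jw A _).val) (idR 1)) (stdCups A _ _ _).val _]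
    conv_lhs => rw [← habsV]
    rw [← compR_assoc (Vd A _ _ _).val (tensR _ _ (jw A _).val (jw A _).val) _,
      compR_assoc (tensR _ _ (jw A _).val (jw A _).val) (tensR _ _ (tensR _ _ (jw A _).val (jw A _).val) (idR 1)) _,
      ← tensR_assoc (X := (jw A (x' + z₀ + 1)).val) (n := x' + z₀ + 1) (m := x' + z₀ + 1) (n' := y' + z₀) (m' := y' + z₀),
      compR_tensR_tensR (jw A (x' + z₀ + 1)).respC (jw A (x' + z₀ + 1)).respR, hidem, habsR,
      show x' + y' - y' = x' by omega]
    simp only [show x' + z₀ + 1 + (y' + z₀) + 1 = x' + z₀ + 1 + (y' + z₀ + 1) by omega,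
      show x' + y' + 1 + 1 = x' + y' + 2 by omega]
    rw [hsw x' (by omega), if_pos rfl, lam]
  · have ht' := Finset.mem_range.mp ht
    rw [compR_smul, trW_smul, ← compR_assoc (Vd A _ _ _).val _ _,
      ← compR_assoc (tensR _ _ (tensR _ _ (jw A _).val (jw A _).val) (idR 1)) (stdCups A _ _ _).val _]
    conv_lhs => rw [← habsV]
    rw [← compR_assoc (Vd A _ _ _).val (tensR _ _ (jw A _).val (jw A _).val) _,
      compR_assoc (tensR _ _ (jw A _).val (jw A _).val) (tensR _ _ (tensR _ _ (jw A _).val (jw A _).val) (idR 1)) _,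
      ← tensR_assoc (X := (jw A (x' + z₀ + 1)).val) (n := x' + z₀ + 1) (m := x' + z₀ + 1) (n' := y' + z₀) (m' := y' + z₀),
      compR_tensR_tensR (jw A (x' + z₀ + 1)).respC (jw A (x' + z₀ + 1)).respR, hidem, habsR]
    simp only [show x' + z₀ + 1 + (y' + z₀) + 1 = x' + z₀ + 1 + (y' + z₀ + 1) by omega,
      show x' + y' + 1 + 1 = x' + y' + 2 by omega]
    rw [hsw (x' + y' - t) (Nat.sub_le _ _), if_neg (by omega), compR_zero, trW_zero', mul_zero]

end Mor


namespace Mor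

variable {A : K}

/-- **The `E₋₋` tetrahedral net**: `Tet = λ(x',y') · θ(x, y, z-1)`. [folklore] -/
theorem Tnet_mm (hA : A ≠ 0) (x' z₀ y' : ℕ) (hgx : Good A (x' + z₀ + 2)) (hgy : Good A (y' + z₀ + 2))
    (hgz : Good A (x' + y' + 2)) :
    Tnet A (x' + z₀ + 1) (y' + z₀ + 1) 1 (x' + y' + 1) (x' + y') (y' + z₀) =
      lam A x' y' * thetaL A (x' + z₀ + 1) (y' + z₀ + 1) (x' + y') := by
  have h1 : Vd A (x' + y') 1 (x' + y' + 1) = jw A (x' + y' + 1) := ext' (Vd_one_up_val hA (x' + y') (hgz.mono (by omega)))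
  rw [Tnet_mm_transpose, h1, ← comp_assoc, ← comp_assoc, trAll_comp_comm hA (IsTL.jw (x' + y' + 1)), ← comp_assoc,
    ← comp_assoc, V_comp_jw hA _ _ _ (hgz.mono (by omega)), idm_tens_Vcup_comp_V hA x' z₀ y' hgy, comp_sum, trAll_sum]
  simp only [comp_smul, trAll_smul]
  rw [Finset.sum_eq_single 0 (fun s hs hs0 => ?_) (fun h => absurd (Finset.mem_range.mpr (by omega)) h)]
  · simp only [pow_zero, one_mul, Nat.sub_zero]
    rw [div_self (hgy _ (by omega)), one_mul, Tnet_mm_s0 hA x' z₀ y' hgx hgy hgz]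
  · have hs' := Finset.mem_range.mp hs
    rw [comp_assoc, Vd_tens_idm_comp_cup' hA _ _ _ _ (by omega) (hgx.mono (by omega)) (hgy.mono (by omega)), zero_comp,
      trAll_eq_trW, zero_val, trW_zero', mul_zero]

/-- **`E₋₋`** (raw form): `F^{x,y,1}_{z; z-1, y-1} = λ(x',y') θ(x,y,z-1) Δ_{y-1} / (θ(x,y-1,z) Δ_y)`
(`x = x'+z₀+1`, `y = y'+z₀+1`, `z = x'+y'+1`). [cite: KauffmanLins1994, §9.12 (special values)] -/
theorem Fco_mm (hA : A ≠ 0) (x' z₀ y' : ℕ) (hgx : Good A (x' + z₀ + 2)) (hgy : Good A (y' + z₀ + 2))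
    (hgz : Good A (x' + y' + 2)) :
    Fco A (x' + z₀ + 1) (y' + z₀ + 1) 1 (x' + y' + 1) (x' + y') (y' + z₀) =
      lam A x' y' * thetaL A (x' + z₀ + 1) (y' + z₀ + 1) (x' + y') * Delta A (y' + z₀) /
        (thetaL A (x' + z₀ + 1) (y' + z₀) (x' + y' + 1) * Delta A (y' + z₀ + 1)) := by
  rw [Fco, Tnet_mm hA x' z₀ y' hgx hgy hgz, thetaL_eq' (A := A) (a := y' + z₀ + 1) (b := 1) (c := y' + z₀) (y' + z₀) 1 0
    rfl rfl rfl, theta_one_zero hA _ hgy]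

end Mor


/-! ### The `E₊₋` network -/

namespace Mor

variable {A : K}

/-- `V(z, 1; z+1) = f_{z+1}`. [folklore] -/
theorem V_one_up (hA : A ≠ 0) (z : ℕ) (hg : Good A (z + 1)) : V A z 1 (z + 1) = jw A (z + 1) := by
  have h := congrArg Mor.val (jw_absorb_left hA (n := z) hg)
  rw [comp_val, tens_val, idm_val] at h
  apply ext'
  rw [V_eq' z 0 1 (by omega) (by omega) (by omega), cast_val, vert_def, stdCups_zero, comp_val, comp_val, idm_val,
    tens_val, jw_val_congr (Nat.add_zero z), jw_val_congr (show 1 + 0 = 1 from rfl), jw_one, idm_val]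
  simp only [Nat.add_zero]
  rw [compR_idR ((jw A z).respC.tensR (RespC.idR 1) _)]
  exact h

/-- `V^∨(z+1, 1; z) = f_z ∩_z (f_{z+1} ⊗ 𝟙)` (the cap vertex). [folklore] -/
theorem Vd_one_down (z : ℕ) : Vd A (z + 1) 1 z = jw A z ⊚ capAt A z z ⊚ (jw A (z + 1) ⊗ₘ idm 1 :) := by
  apply ext'
  rw [Vd_eq' z 1 0 rfl (by omega) (by omega), cast_val, dvert_def, stdCaps_succ, stdCaps_zero, comp_val, comp_val,
    cast_val, comp_val, idm_val, tens_val, jw_val_congr (Nat.add_zero z), jw_val_congr (show 0 + 1 = 1 from rfl), jw_one,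
    idm_val, capAt_val_congr A (show z + 0 + (0 + 0) = z by omega) (Nat.add_zero z), comp_val, comp_val, tens_val, idm_val]
  simp only [Nat.add_zero]
  rw [idR_compR (capAt A z z).respR]

/-- `V^∨(x,y;c) (𝟙_x ⊗ f_y) = V^∨(x,y;c)`. [folklore] -/
theorem Vd_comp_idm_tens_jw (hA : A ≠ 0) (x y c : ℕ) (hgx : Good A x) (hgy : Good A y) :
    Vd A x y c ⊚ (idm x ⊗ₘ jw A y) = Vd A x y c := by
  have h := congrArg Mor.val (Vd_comp_jw_tens_jw hA x y c hgx hgy)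
  rw [comp_val, tens_val] at h
  have hidem := congrArg Mor.val (jw_idem' hA (n := y) hgy)
  rw [comp_val] at hidem
  apply ext'
  rw [comp_val, tens_val, idm_val, ← h, ← compR_assoc, compR_tensR_tensR (jw A x).respC (RespR.idR x),
    compR_idR (jw A x).respC, hidem]

/-- `θ(x, y, z+1) = tr( V^∨(x,y;z+1) (V(x,y-1;z) ⊗ 𝟙) )` (`x = x̂+ẑ`, `y = y₀+ẑ+1`, `z = x̂+y₀`). [folklore] -/
theorem thetaL_up_eq (hA : A ≠ 0) (x₁ z₁ y₀ : ℕ) (hgx : Good A (x₁ + z₁ + 1)) (hgy : Good A (y₀ + z₁ + 2))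
    (hgz : Good A (x₁ + y₀ + 2)) :
    thetaL A (x₁ + z₁) (y₀ + z₁ + 1) (x₁ + y₀ + 1) =
      trAll A (Vd A (x₁ + z₁) (y₀ + z₁ + 1) (x₁ + y₀ + 1) ⊚ (V A (x₁ + z₁) (y₀ + z₁) (x₁ + y₀) ⊗ₘ idm 1 :)) := by
  rw [thetaL, ← treeL_mp hA x₁ z₁ y₀ hgy hgz, treeL, V_one_up hA _ (hgz.mono (by omega)), comp_assoc, comp_assoc,
    ← trAll_comp_comm hA (IsTL.jw (x₁ + y₀ + 1)), comp_assoc, comp_assoc, jw_comp_Vd hA _ _ _ (hgz.mono (by omega)),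
    Vd_comp_idm_tens_jw hA _ _ _ (hgx.mono (by omega)) (hgy.mono (by omega))]

end Mor


namespace Mor

variable {A : K}

/-- Expanding the cup vertex `V(y,1;y-1)` in the right block of `V(x,y-1;z)` (general labels
`x = x₁+z₁`, `y - 1 = y₀+z₁`, `z = x₁+y₀`). [folklore] -/
theorem idm_tens_Vcup_comp_V' (hA : A ≠ 0) (x₁ z₁ y₀ : ℕ) (hgy : Good A (y₀ + z₁ + 2))
    (h1 : x₁ + z₁ + (y₀ + z₁ + 1 + 1) = x₁ + z₁ + (y₀ + z₁ + 1) + 1)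
    (h2 : x₁ + z₁ + (y₀ + z₁ + 2) = x₁ + z₁ + (y₀ + z₁ + 1) + 1) :
    ((idm (x₁ + z₁) ⊗ₘ V A (y₀ + z₁ + 1) 1 (y₀ + z₁) :).cast rfl h1) ⊚ V A (x₁ + z₁) (y₀ + z₁) (x₁ + y₀) =
    ∑ s ∈ Finset.range (y₀ + z₁ + 1), ((-1 : K) ^ s * (Delta A (y₀ + z₁ - s) / Delta A (y₀ + z₁))) •
      (((idm (x₁ + z₁) ⊗ₘ cupAt A (y₀ + z₁) (y₀ + z₁ - s) :).cast rfl h2) ⊚ V A (x₁ + z₁) (y₀ + z₁) (x₁ + y₀)) := by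
  have hb := congrArg Mor.val (bend_jw hA (y₀ + z₁) 0 (hgy.mono (by omega)))
  simp only [comp_val, cast_val, tens_val, idm_val, cup_val, sum_val, smul_val, Nat.add_zero, tensR_idR_zero] at hb
  rw [jw_val_congr (show 0 + (y₀ + z₁) = y₀ + z₁ by omega)] at hb
  simp only [show 0 + (y₀ + z₁) = y₀ + z₁ by omega, cupAt_val_congr A (show 0 + (y₀ + z₁) = y₀ + z₁ by omega) rfl] at hb
  have hcl := congrArg Mor.val (cupAt_last (A := A) (y₀ + z₁))
  rw [cast_val, tens_val, idm_val, cup_val] at hcl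
  have hidem := congrArg Mor.val (jw_idem' hA (n := y₀ + z₁) (hgy.mono (by omega)))
  rw [comp_val] at hidem
  rw [V_eq' (y₀ + z₁) 1 0 rfl (by omega) (by omega), V_eq' x₁ z₁ y₀ rfl rfl rfl, vert_def A (y₀ + z₁) 1 0, stdCups_succ,
    stdCups_zero]
  apply ext'
  simp only [comp_val, cast_val, tens_val, idm_val, sum_val, smul_val, Nat.add_zero, vert_def]
  rw [jw_val_congr (show 0 + 1 = 1 from rfl), jw_one, idm_val, compR_idR (cupAt A _ _).respC, hcl]
  simp only [show (0 : ℕ) + 1 = 1 from rfl]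
  rw [hb, tensR_sum, sum_compR]
  refine Finset.sum_congr rfl (fun s _ => ?_)
  rw [tensR_smul, smul_compR, idR_tensR_compR,
    ← compR_assoc (tensR _ _ (idR _) (cupAt A _ _).val) (tensR _ _ (idR _) (jw A _).val) _,
    ← compR_assoc (tensR _ _ (jw A _).val (jw A _).val) (stdCups A _ _ _).val (jw A _).val,
    compR_assoc (tensR _ _ (idR _) (jw A _).val) (tensR _ _ (jw A _).val (jw A _).val) _,
    compR_tensR_tensR (RespC.idR _) (jw A _).respR, idR_compR (jw A _).respR, hidem,
    compR_assoc (tensR _ _ (jw A _).val (jw A _).val) (stdCups A _ _ _).val (jw A _).val]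

/-- The `E₊₋` network, transposed. [folklore] -/
theorem Tnet_pm_transpose (x₁ z₁ y₀ : ℕ) :
    Tnet A (x₁ + z₁) (y₀ + z₁ + 1) 1 (x₁ + y₀) (x₁ + y₀ + 1) (y₀ + z₁) =
      trAll A (Vd A (x₁ + y₀ + 1) 1 (x₁ + y₀) ⊚ (Vd A (x₁ + z₁) (y₀ + z₁ + 1) (x₁ + y₀ + 1) ⊗ₘ idm 1 :) ⊚
        ((idm (x₁ + z₁) ⊗ₘ V A (y₀ + z₁ + 1) 1 (y₀ + z₁) :).cast rfl (by omega)) ⊚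
        V A (x₁ + z₁) (y₀ + z₁) (x₁ + y₀)) := by
  have hu : (-1 : K) ^ z₁ * (-1) ^ z₁ = 1 := by rw [← mul_pow, neg_one_mul, neg_neg, one_pow]
  rw [Tnet, ← trAll_trpm, trpm_comp, treeL, treeRd, trpm_comp, trpm_comp, trpm_cast, trpm_tens, trpm_tens, trpm_idm,
    trpm_idm, trpm_V, trpm_V, trpm_Vd, trpm_Vd,
    show (x₁ + y₀ + 1 + 1 - (x₁ + y₀)) / 2 = 1 by omega,
    show (x₁ + z₁ + (y₀ + z₁ + 1) - (x₁ + y₀ + 1)) / 2 = z₁ by omega,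
    show (y₀ + z₁ + 1 + 1 - (y₀ + z₁)) / 2 = 1 by omega,
    show (x₁ + z₁ + (y₀ + z₁) - (x₁ + y₀)) / 2 = z₁ by omega,
    pow_one, smul_tens, tens_smul, cast_smul]
  simp only [smul_comp, comp_smul, smul_smul, trAll_smul, comp_assoc]
  linear_combination (trAll A (Vd A (x₁ + y₀ + 1) 1 (x₁ + y₀) ⊚ (Vd A (x₁ + z₁) (y₀ + z₁ + 1) (x₁ + y₀ + 1) ⊗ₘ idm 1 :) ⊚
        ((idm (x₁ + z₁) ⊗ₘ V A (y₀ + z₁ + 1) 1 (y₀ + z₁) :).cast rfl (by omega)) ⊚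
        V A (x₁ + z₁) (y₀ + z₁) (x₁ + y₀))) * hu

end Mor


namespace Mor

variable {A : K}

/-- The surviving term of the `E₊₋` network is `θ(x, y, z+1)`. [folklore] -/
theorem Tnet_pm_s0 (hA : A ≠ 0) (x₁ z₁ y₀ : ℕ) (hgx : Good A (x₁ + z₁ + 1)) (hgy : Good A (y₀ + z₁ + 2))
    (hgz : Good A (x₁ + y₀ + 2)) (h2 : x₁ + z₁ + (y₀ + z₁ + 2) = x₁ + z₁ + (y₀ + z₁ + 1) + 1) :
    trAll A (Vd A (x₁ + y₀ + 1) 1 (x₁ + y₀) ⊚ ((Vd A (x₁ + z₁) (y₀ + z₁ + 1) (x₁ + y₀ + 1) ⊗ₘ idm 1 :) ⊚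
      ((((idm (x₁ + z₁) ⊗ₘ cupAt A (y₀ + z₁) (y₀ + z₁) :).cast rfl h2) ⊚ V A (x₁ + z₁) (y₀ + z₁) (x₁ + y₀))))) =
    thetaL A (x₁ + z₁) (y₀ + z₁ + 1) (x₁ + y₀ + 1) := by
  have hcl := congrArg Mor.val (cupAt_last (A := A) (y₀ + z₁))
  rw [cast_val, tens_val, idm_val, cup_val] at hcl
  have hcapl := congrArg Mor.val (capAt_last (A := A) (x₁ + y₀))
  rw [cast_val, tens_val, idm_val, cap_val] at hcapl
  rw [Vd_one_down, comp_assoc, ← comp_assoc (jw A (x₁ + y₀) ⊚ capAt A (x₁ + y₀) (x₁ + y₀)), tens_idm_comp_tens_idm,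
    jw_comp_Vd hA _ _ _ (hgz.mono (by omega))]
  have eS : jw A (x₁ + y₀) ⊚ capAt A (x₁ + y₀) (x₁ + y₀) ⊚ (Vd A (x₁ + z₁) (y₀ + z₁ + 1) (x₁ + y₀ + 1) ⊗ₘ idm 1 :) ⊚
      ((((idm (x₁ + z₁) ⊗ₘ cupAt A (y₀ + z₁) (y₀ + z₁) :).cast rfl h2) ⊚ V A (x₁ + z₁) (y₀ + z₁) (x₁ + y₀))) =
      jw A (x₁ + y₀) ⊚ (rptr A (Vd A (x₁ + z₁) (y₀ + z₁ + 1) (x₁ + y₀ + 1)) ⊚ V A (x₁ + z₁) (y₀ + z₁) (x₁ + y₀)) := by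
    apply ext'
    simp only [comp_val, cast_val, tens_val, idm_val, rptr_val, hcl, hcapl]
    rw [tensR_assoc, tensR_idR_idR]
    simp only [← compR_assoc]
    rfl
  rw [eS, trAll_comp_comm hA (IsTL.jw (x₁ + y₀)), ← comp_assoc, V_comp_jw hA _ _ _ (hgz.mono (by omega)),
    ← rptr_comp_tens_idm, ← trAll_succ, ← thetaL_up_eq hA x₁ z₁ y₀ hgx hgy hgz]

end Mor


namespace Mor

variable {A : K}

/-- **The `E₊₋` tetrahedral net**: `Tet = θ(x, y, z+1)`. [folklore] -/
theorem Tnet_pm (hA : A ≠ 0) (x₁ z₁ y₀ : ℕ) (hgx : Good A (x₁ + z₁ + 1)) (hgy : Good A (y₀ + z₁ + 2))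
    (hgz : Good A (x₁ + y₀ + 2)) :
    Tnet A (x₁ + z₁) (y₀ + z₁ + 1) 1 (x₁ + y₀) (x₁ + y₀ + 1) (y₀ + z₁) = thetaL A (x₁ + z₁) (y₀ + z₁ + 1) (x₁ + y₀ + 1) := by
  rw [Tnet_pm_transpose, ← comp_assoc, ← comp_assoc,
    idm_tens_Vcup_comp_V' hA x₁ z₁ y₀ hgy _ (by omega), comp_sum, comp_sum, trAll_sum]
  simp only [comp_smul, trAll_smul]
  rw [Finset.sum_eq_single 0 (fun s hs hs0 => ?_) (fun h => absurd (Finset.mem_range.mpr (by omega)) h)]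
  · simp only [pow_zero, one_mul, Nat.sub_zero]
    rw [div_self (hgy _ (by omega)), one_mul, Tnet_pm_s0 hA x₁ z₁ y₀ hgx hgy hgz]
  · have hs' := Finset.mem_range.mp hs
    rw [comp_assoc (Vd A _ _ _ ⊗ₘ idm 1 :),
      Vd_tens_idm_comp_cup' hA _ _ _ _ (by omega) (hgx.mono (by omega)) (hgy.mono (by omega)), zero_comp, comp_zero,
      trAll_eq_trW, zero_val, trW_zero', mul_zero]

/-- **`E₊₋`** (raw form): `F^{x,y,1}_{z; z+1, y-1} = θ(x,y,z+1) Δ_{y-1} / (θ(x,y-1,z) Δ_y)`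
(`x = x₁+z₁`, `y = y₀+z₁+1`, `z = x₁+y₀`). [cite: KauffmanLins1994, §9.12 (special values)] -/
theorem Fco_pm (hA : A ≠ 0) (x₁ z₁ y₀ : ℕ) (hgx : Good A (x₁ + z₁ + 1)) (hgy : Good A (y₀ + z₁ + 2))
    (hgz : Good A (x₁ + y₀ + 2)) :
    Fco A (x₁ + z₁) (y₀ + z₁ + 1) 1 (x₁ + y₀) (x₁ + y₀ + 1) (y₀ + z₁) =
      thetaL A (x₁ + z₁) (y₀ + z₁ + 1) (x₁ + y₀ + 1) * Delta A (y₀ + z₁) /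
        (thetaL A (x₁ + z₁) (y₀ + z₁) (x₁ + y₀) * Delta A (y₀ + z₁ + 1)) := by
  rw [Fco, Tnet_pm hA x₁ z₁ y₀ hgx hgy hgz, thetaL_eq' (A := A) (a := y₀ + z₁ + 1) (b := 1) (c := y₀ + z₁) (y₀ + z₁) 1 0
    rfl rfl rfl, theta_one_zero hA _ hgy]

end Mor



end TemperleyLieb

end Literature.RepresentationTheory.ModularTensorCategories
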